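import Literature.Barriers.CriticalPhenomena.GridSAWLOTDrawing
import Literature.Combinatorics.SimpleGraph.HamiltonianLOTAdjacency
import HarnessLib

/-!
# The grid drawing of the `#3SAT → #HamPath` gadget graph, II: the dictionary

Every local edge of every placed tile joins the global numbers of its ends by an edge of the gadget
graph `graph₂ φ` (`HamiltonianLOTCount.lean`), and conversely every edge of `graph₂ φ` is a local
edge of some placed tile. With part I this assembles the structured grid drawing of `graph₂ φ` and
transfers the Hamiltonian path count.

## References

* M. Liśkiewicz, M. Ogihara, S. Toda, TCS 304 (2003) 129–156, §4 (proof of Theorem 7, `E₀`).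
-/

namespace Literature.Barriers.CriticalPhenomena.GridSAW

namespace LOTDrawing

open Literature.Computability.Complexity Literature.Combinatorics.SimpleGraph
open Literature.Combinatorics.SimpleGraph.LOTReduction LOTTiles

variable {φ : CNF ℕ}

/-! ### Template edges, named -/

/-- Membership in a rail family. [folklore] -/
theorem mem_railE {a b n : ℕ} {e : (ℕ × ℕ) × (ℕ × ℕ)} : e ∈ railE a b n ↔ ∃ t < n, e = ((a, b + t), (a, b + t + 1)) := by
  unfold railE; simp only [List.mem_map, List.mem_range]
  exact ⟨fun ⟨t, ht, h⟩ => ⟨t, ht, h.symm⟩, fun ⟨t, ht, h⟩ => ⟨t, ht, h.symm⟩⟩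

/-- Membership in a rung family. [folklore] -/
theorem mem_rungE {a b m n : ℕ} {e : (ℕ × ℕ) × (ℕ × ℕ)} : e ∈ rungE a b m n ↔ ∃ t < n, e = ((a, b + t), (a, m + t)) := by
  unfold rungE; simp only [List.mem_map, List.mem_range]
  exact ⟨fun ⟨t, ht, h⟩ => ⟨t, ht, h.symm⟩, fun ⟨t, ht, h⟩ => ⟨t, ht, h.symm⟩⟩

/-- Rail edges of the XOR-gadget, numbered. [folklore] -/
theorem xor_rail {b : ℕ} {p : (ℕ × ℕ) × (ℕ × ℕ)} (r : ℕ) (hr : r < 2) {t : ℕ} (ht : t < 3)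
    (H : ∀ {x y : RailV 2 4 4}, RailXOR.Γ.graph.Adj x y → (graph₂ φ).Adj (railNum (K := 4) b (ends₂ p) x) (railNum (K := 4) b (ends₂ p) y)) :
    (graph₂ φ).Adj (b + (r * 4 + t)) (b + (r * 4 + (t + 1))) :=
  H (RailXOR.adj_rail ⟨r, hr⟩ ⟨t, by omega⟩ ⟨t + 1, by omega⟩ rfl)

/-- Rung halves of the XOR-gadget, numbered. [folklore] -/
theorem xor_rung {b : ℕ} {p : (ℕ × ℕ) × (ℕ × ℕ)} (r : ℕ) (hr : r < 2) {t : ℕ} (ht : t < 4)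
    (H : ∀ {x y : RailV 2 4 4}, RailXOR.Γ.graph.Adj x y → (graph₂ φ).Adj (railNum (K := 4) b (ends₂ p) x) (railNum (K := 4) b (ends₂ p) y)) :
    (graph₂ φ).Adj (b + (r * 4 + t)) (b + (2 * 4 + t)) :=
  H (RailXOR.adj_rung ⟨r, hr⟩ ⟨t, ht⟩)

/-- Port edges of the XOR-gadget, numbered. [folklore] -/
theorem xor_ports {b : ℕ} {p : (ℕ × ℕ) × (ℕ × ℕ)}
    (H : ∀ {x y : RailV 2 4 4}, RailXOR.Γ.graph.Adj x y → (graph₂ φ).Adj (railNum (K := 4) b (ends₂ p) x) (railNum (K := 4) b (ends₂ p) y)) :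
    (graph₂ φ).Adj p.1.1 (b + (0 * 4 + 0)) ∧ (graph₂ φ).Adj p.1.2 (b + (0 * 4 + 3)) ∧
      (graph₂ φ).Adj p.2.1 (b + (1 * 4 + 0)) ∧ (graph₂ φ).Adj p.2.2 (b + (1 * 4 + 3)) :=
  ⟨H (RailXOR.adj_port 0).1, H (RailXOR.adj_port 0).2, H (RailXOR.adj_port 1).1, H (RailXOR.adj_port 1).2⟩

/-! ### Every expected key pair of a site is an edge of the gadget graph -/

/-- Next cells. [folklore] -/
theorem cells_site (r s : ℕ) : wIdx φ r s = blIdx φ r s + 1 ∧ blIdx φ r (s + 1) = blIdx φ r s + 2 ∧ brIdx φ r s = blIdx φ r s + 2 := by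
  unfold wIdx blIdx brIdx rowCell; omega

/-- **Every expected key pair of a site tile is an edge of `graph₂`** between the global numbers of
the keys. [folklore] -/
theorem siteEdges_adj (hN : 0 < N φ) (hN3 : N φ = 3 * T φ + 1) {r s : ℕ} (hr : r < N φ) (hs : s < N φ) :
    ∀ e ∈ siteEdges (sF1 s) (sF2 φ s) (sF3 φ r s) (sF4 φ r s) (sF5 φ r s),
      (graph₂ φ).Adj ((PD.site r s).ν φ e.1) ((PD.site r s).ν φ e.2) := by
  intro e he
  -- the column through the site is `J r s`
  have hJ : J φ r s < N φ := J_lt hs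
  have hcs : J φ r (J φ r s) = s := J_J hs
  obtain ⟨hw1, hbl2, hbr2⟩ := cells_site (φ := φ) r s
  have hMbl : blIdx φ r s < M φ := rowCell_lt_M hr (by omega)
  have hMw : wIdx φ r s < M φ := rowCell_lt_M hr (by omega)
  have hMbl2 : blIdx φ r s + 2 < M φ := by have := rowCell_lt_M (φ := φ) (k := 2 * s + 2) hr (by omega); unfold blIdx at *; unfold rowCell at *; omega
  have h5M := five_cell_lt_base1 φ hMbl2
  -- no row cell is a dummy, clause or free cell; bus and door cells differ
  have hle := le_rowCell (φ := φ) r (2 * s)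
  have hltK : ∀ k ≤ 2 * N φ, rowCell φ r k < kIdx φ 0 := fun k hk => lt_of_lt_of_le (rowCell_lt hr hk) (le_kIdx 0)
  have hKinj : ∀ c', kIdx φ c' = kIdx φ 0 + c' := fun c' => by unfold kIdx; omega
  -- the hop ladders of the column and the exit ladder
  have Hhop : ∀ h < 5, ∀ {x y : RailV 2 4 4}, RailXOR.Γ.graph.Adj x y →
      (graph₂ φ).Adj (railNum (K := 4) (hopBase φ (J φ r s) r h) (ends₂ (hopSlots' φ (J φ r s) r h)) x) (railNum (K := 4) (hopBase φ (J φ r s) r h) (ends₂ (hopSlots' φ (J φ r s) r h)) y) :=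
    fun h hh x y hxy => adj₂_hop hJ hr hh hxy
  have hb4 : ∀ h, hopBase φ (J φ r s) r h = base2 φ + 60 * ((J φ r s) * N φ + r) + 12 * h := fun h => by unfold hopBase; ring
  have hb5 : r + 1 < N φ → hopBase φ (J φ r s) (r + 1) 0 = base2 φ + 60 * ((J φ r s) * N φ + (r + 1)) := fun _ => by unfold hopBase; ring
  have hk5 : klinkBase φ (J φ r s) = base2 φ + 12 * (5 * (N φ * N φ) + N φ + (J φ r s)) := by unfold klinkBase; ring
  simp only [siteEdges, List.mem_append] at he
  simp only [PD.ν]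
  rcases he with ((((((((((((((((((he | he) | he) | he) | he) | he) | he) | he) | he) | he) | he) | he) | he) | he) | he) | he) | he) | he) | he) | he
  · -- the chain edges of `Bl` and `W` always present
    simp only [List.mem_cons, List.not_mem_nil, or_false] at he
    have ew : ∀ d, 5 * blIdx φ r s + (5 + d) = 5 * wIdx φ r s + d := fun d => by omega
    rcases he with rfl | rfl | rfl | rfl | rfl | rfl | rfl | rfl <;> simp only [siteAnchor]
    · exact adj₂_chain (by omega) (by omega) (notSlot_cp hN hMbl)
    · exact adj₂_chain (by omega) (by omega) (notSlot_ab hN hMbl)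
    · exact adj₂_chain (by omega) (by omega) (notSlot_qc hN (by omega))
    · rw [show 5 * blIdx φ r s + 5 = 5 * wIdx φ r s by omega, ew 1]
      exact adj₂_chain (by omega) (by omega) (notSlot_cp hN hMw)
    · rw [ew 2, ew 3]
      exact adj₂_chain (by omega) (by omega) (notSlot_ab hN hMw)
    · rw [ew 2, ew 4]
      exact adj₂_chain (by omega) (by omega)
        (notSlot_UR hN hMw (fun r' j' _ hj' h => blIdx_ne_wIdx (φ := φ) (r := r') (s := j') (r' := r) (s' := s) (by omega) hs h.symm))
    · rw [ew 3, ew 4]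
      exact adj₂_chain (by omega) (by omega)
        (notSlot_LR hN hMw (fun c' _ h => absurd h (by have := hltK (2 * s + 1) (by omega); rw [hKinj c']; unfold wIdx; omega))
          (fun c' hc' h => absurd h (by have := dIdx_lt hc'; have := le_rowCell (φ := φ) r (2 * s + 1); unfold wIdx; omega))
          (fun r' c' _ hc' h => absurd h.symm (blIdx_ne_wIdx (by have := J_lt (φ := φ) (r := r') hc'; omega) hs)))
    · rw [ew 4, ew 5]
      exact adj₂_chain (by omega) (by omega) (notSlot_qc hN (i := wIdx φ r s) (by omega))
  · -- `Bl.p – Bl.a` at the first site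
    revert he; cases hf : sF1 s <;> simp only [Bool.false_eq_true, if_false, if_true, List.not_mem_nil, List.mem_singleton, false_imp_iff]
    rintro rfl; simp only [siteAnchor]
    have hs0 : s = 0 := by simpa [sF1] using hf
    refine adj₂_chain (by omega) (by omega) (notSlot_UL hN hMbl hle ?_ ?_ ?_)
    · intro r' j' _ hj' h; rw [brIdx_eq] at h; have := blIdx_inj (φ := φ) (by omega) (by omega) h; omega
    · intro r' j' _ hj' h; exact blIdx_ne_wIdx (by omega) hj' h
    · intro c' _ h; have := hltK (2 * s) (by omega); rw [hKinj c'] at h; unfold blIdx at h; omega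
  · -- `Bl.p – Bl.b` unless the second set slot
    revert he; cases h5 : sF5 φ r s <;> simp only [Bool.false_eq_true, if_false, if_true, List.not_mem_nil, List.mem_singleton, false_imp_iff]
    rintro rfl; simp only [siteAnchor]
    refine adj₂_chain (by omega) (by omega) (notSlot_LL hN hMbl ?_ ?_ ?_ ?_ ?_ ?_)
    · intro c' _ h; have := hltK (2 * s) (by omega); rw [hKinj c'] at h; unfold blIdx at h; omega
    · intro c' hc' h; exact absurd h (blIdx_ne_wIdx (by omega) (J_lt hc'))
    · intro c' hc' h; have := dIdx_lt hc'; unfold blIdx at h; omega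
    · intro c' hc' h
      rw [brIdx_eq] at h
      obtain ⟨rfl, hss⟩ := blIdx_inj (φ := φ) (by omega) (by have := J_lt (φ := φ) (r := c') hc'; omega) h
      cases hp : (prev? φ r).isSome
      · rfl
      · rw [sF5, hp, Bool.and_true, decide_eq_false_iff_not] at h5; omega
    · intro c' hc' h; have := d'Idx_lt hc'; unfold blIdx at h; omega
    · intro r' c' _ hc' h; exact absurd h (blIdx_ne_wIdx (by omega) (J_lt hc'))
  · -- `Bl.b – Bl.q` unless the column taps here
    revert he; cases h3 : sF3 φ r s <;> simp only [Bool.false_eq_true, if_false, if_true, List.not_mem_nil, List.mem_singleton, false_imp_iff]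
    rintro rfl; simp only [siteAnchor]
    have ht : ¬ IsTap φ r (J φ r s) := by simpa [sF3] using h3
    refine adj₂_chain (by omega) (by omega) (notSlot_LR hN hMbl ?_ ?_ ?_)
    · intro c' _ h; have := hltK (2 * s) (by omega); rw [hKinj c'] at h; unfold blIdx at h; omega
    · intro c' hc' h; have := dIdx_lt hc'; unfold blIdx at h; omega
    · intro r' c' _ hc' h
      obtain ⟨rfl, hss⟩ := blIdx_inj (φ := φ) (by omega) (by have := J_lt (φ := φ) (r := r') hc'; omega) h
      rw [hss, J_J hc'] at ht; exact ht
  · -- `W.p – W.b` when the column taps here and the set ladder is not here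
    revert he
    cases h3 : sF3 φ r s <;> cases h4 : sF4 φ r s <;>
      simp only [Bool.true_and, Bool.false_and, Bool.not_true, Bool.not_false, Bool.false_eq_true, if_false, if_true, List.not_mem_nil,
        List.mem_singleton, false_imp_iff]
    rintro rfl; simp only [siteAnchor]
    have ht : IsTap φ r (J φ r s) := by simpa [sF3] using h3
    have ew : ∀ d, 5 * blIdx φ r s + (5 + d) = 5 * wIdx φ r s + d := fun d => by omega
    rw [ew 1, ew 3]
    refine adj₂_chain (by omega) (by omega) (notSlot_LL hN hMw ?_ ?_ ?_ ?_ ?_ ?_)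
    · intro c' _ h; have := hltK (2 * s + 1) (by omega); rw [hKinj c'] at h; unfold wIdx at h; omega
    · intro c' hc' h
      obtain ⟨rfl, hss⟩ := wIdx_inj (φ := φ) hs (J_lt hc') h
      cases hp : (prev? φ r).isSome
      · rfl
      · rw [sF4, hp, Bool.and_true, decide_eq_false_iff_not] at h4; exact absurd hss h4
    · intro c' hc' h; have := dIdx_lt hc'; have := le_rowCell (φ := φ) r (2 * s + 1); unfold wIdx at h; omega
    · intro c' hc' h; rw [brIdx_eq] at h; exact absurd h.symm (blIdx_ne_wIdx (by have := J_lt (φ := φ) (r := c') hc'; omega) hs)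
    · intro c' hc' h; have := d'Idx_lt hc'; have := le_rowCell (φ := φ) r (2 * s + 1); unfold wIdx at h; omega
    · intro r' c' _ hc' h
      obtain ⟨rfl, hss⟩ := wIdx_inj (φ := φ) hs (J_lt hc') h
      rw [hss, J_J hc'] at ht; exact ht
  · -- the ports of the diamond ladder at `Bl`
    simp only [List.mem_cons, List.not_mem_nil, or_false] at he
    obtain ⟨p1, p2, -, -⟩ := adj₂_dl_ports (φ := φ) hr hs
    rcases he with rfl | rfl <;> simp only [siteAnchor]
    exacts [p1, p2]
  · -- the rail `v₀ v₁ v₂ v₃`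
    obtain ⟨t, ht, rfl⟩ := mem_railE.1 he
    simp only [siteAnchor, Nat.zero_add]
    interval_cases t
    · exact adj₂_dl_inner hr hs (by omega) (by omega) (Or.inl (by decide)) (by omega)
    · exact adj₂_dl_inner hr hs (by omega) (by omega) (Or.inl (by decide)) (by omega)
    · exact adj₂_dl_inner hr hs (by omega) (by omega) (Or.inl (by decide)) (by omega)
  · -- the diamonds: `vₖ pₖ`, `aₖ bₖ`, `aₖ qₖ`, `bₖ qₖ`
    simp only [List.mem_flatMap, List.mem_range, List.mem_cons, List.not_mem_nil, or_false] at he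
    obtain ⟨k, hk, he⟩ := he
    rcases he with rfl | rfl | rfl | rfl <;> simp only [siteAnchor] <;> interval_cases k <;>
      exact adj₂_dl_inner hr hs (by omega) (by omega) (Or.inl (by decide)) (by omega)
  · -- the second rail of the previous site's ladder, with `q – w` and its ports
    revert he; cases hf : sF1 s <;> simp only [Bool.false_eq_true, if_false, if_true, List.not_mem_nil, false_imp_iff, List.mem_append,
      List.mem_map, List.mem_range, List.mem_cons, or_false]
    have hs1 : 1 ≤ s := by simp [sF1] at hf; omega
    obtain ⟨s, rfl⟩ : ∃ s', s = s' + 1 := ⟨s - 1, by omega⟩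
    have hs' : s < N φ := by omega
    rintro ((he | ⟨k, hk, rfl⟩) | rfl | rfl) <;> simp only [siteAnchor, Nat.add_sub_cancel]
    · obtain ⟨t, ht, rfl⟩ := mem_railE.1 he
      simp only
      interval_cases t
      · exact adj₂_dl_inner hr hs' (by omega) (by omega) (Or.inl (by decide)) (by omega)
      · exact adj₂_dl_inner hr hs' (by omega) (by omega) (Or.inl (by decide)) (by omega)
      · exact adj₂_dl_inner hr hs' (by omega) (by omega) (Or.inl (by decide)) (by omega)
    · interval_cases k <;> exact adj₂_dl_inner hr hs' (by omega) (by omega) (Or.inr (by decide)) (by omega)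
    · exact (adj₂_dl_ports hr hs').2.2.2
    · exact (adj₂_dl_ports hr hs').2.2.1
  · -- the last site: its own second rail, `Bl_N`, and the entry of the next row
    revert he; cases hl : sF2 φ s <;> simp only [Bool.false_eq_true, if_false, if_true, List.not_mem_nil, false_imp_iff, List.mem_append,
      List.mem_map, List.mem_range, List.mem_cons, or_false]
    have hsN : s + 1 = N φ := by simpa [sF2] using hl
    have hMN : blIdx φ r (s + 1) < M φ := by rw [hbl2]; exact hMbl2
    have eN : ∀ d, 5 * blIdx φ r s + (10 + d) = 5 * blIdx φ r (s + 1) + d := fun d => by omega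
    rintro (((he | ⟨k, hk, rfl⟩) | rfl | rfl | rfl | rfl | rfl | rfl | rfl) | he) <;> try simp only [siteAnchor]
    · obtain ⟨t, ht, rfl⟩ := mem_railE.1 he
      dsimp only
      interval_cases t
      · exact adj₂_dl_inner hr hs (by omega) (by omega) (Or.inl (by decide)) (by omega)
      · exact adj₂_dl_inner hr hs (by omega) (by omega) (Or.inl (by decide)) (by omega)
      · exact adj₂_dl_inner hr hs (by omega) (by omega) (Or.inl (by decide)) (by omega)
    · interval_cases k <;> exact adj₂_dl_inner hr hs (by omega) (by omega) (Or.inr (by decide)) (by omega)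
    · rw [eN 1]; exact (adj₂_dl_ports hr hs).2.2.2
    · rw [eN 2]; exact (adj₂_dl_ports hr hs).2.2.1
    · rw [show 5 * blIdx φ r s + 10 = 5 * blIdx φ r (s + 1) by omega, eN 1]
      exact adj₂_chain (by omega) (by omega) (notSlot_cp hN hMN)
    · rw [eN 2, eN 3]; exact adj₂_chain (by omega) (by omega) (notSlot_ab hN hMN)
    · rw [eN 2, eN 4]
      refine adj₂_chain (by omega) (by omega) (notSlot_UR hN hMN fun r' j' _ hj' h => ?_)
      have := blIdx_inj (φ := φ) (by omega) (by omega) h; omega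
    · rw [eN 3, eN 4]
      refine adj₂_chain (by omega) (by omega) (notSlot_LR hN hMN ?_ ?_ ?_)
      · intro c' _ h; have := hltK (2 * (s + 1)) (by omega); rw [hKinj c'] at h; unfold blIdx at h; omega
      · intro c' hc' h; have := dIdx_lt hc'; have := le_rowCell (φ := φ) r (2 * (s + 1)); unfold blIdx at h; omega
      · intro r' c' _ hc' h
        have := blIdx_inj (φ := φ) (by omega) (by have := J_lt (φ := φ) (r := r') hc'; omega) h
        have := J_lt (φ := φ) (r := r') hc'; omega
    · -- `q(Bl_N)` to the entry of the next row
      rw [eN 4]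
      have hXC : (if r + 1 < N φ then 5 * blIdx φ (r + 1) 0 else 5 * kIdx φ 0) = 5 * blIdx φ r (s + 1) + 5 := by
        split_ifs with h1
        · unfold blIdx rowCell; rw [rowStart_succ]; omega
        · unfold blIdx rowCell rowStart kIdx
          obtain rfl : r = N φ - 1 := by omega
          have : (N φ - 1) * (2 * N φ + 1) + (2 * N φ + 1) = N φ * (2 * N φ + 1) := by
            rw [← Nat.succ_mul]; congr 1; omega
          omega
      have hM1 : blIdx φ r (s + 1) + 1 < M φ := by
        have h1 : (r + 1) * (2 * N φ + 1) ≤ N φ * (2 * N φ + 1) := Nat.mul_le_mul_right _ hr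
        have h2 : (r + 1) * (2 * N φ + 1) = r * (2 * N φ + 1) + (2 * N φ + 1) := by ring
        unfold blIdx rowCell rowStart M; omega
      rw [hXC]
      exact adj₂_chain (by omega) (by omega) (notSlot_qc hN (i := blIdx φ r (s + 1)) hM1)
    · -- the set ladder's second rail at `Bl_N`, or `p b` of `Bl_N`
      revert he; cases h4 : sF4 φ r s <;> simp only [Bool.false_eq_true, if_false, if_true, List.mem_cons, List.not_mem_nil, or_false]
      · rintro rfl; simp only
        rw [eN 1, eN 3]
        refine adj₂_chain (by omega) (by omega) (notSlot_LL hN hMN ?_ ?_ ?_ ?_ ?_ ?_)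
        · intro c' _ h; have := hltK (2 * (s + 1)) (by omega); rw [hKinj c'] at h; unfold blIdx at h; omega
        · intro c' hc' h; exact absurd h (blIdx_ne_wIdx (by omega) (J_lt hc'))
        · intro c' hc' h; have := dIdx_lt hc'; have := le_rowCell (φ := φ) r (2 * (s + 1)); unfold blIdx at h; omega
        · intro c' hc' h
          rw [brIdx_eq] at h
          obtain ⟨rfl, hss⟩ := blIdx_inj (φ := φ) (by omega) (by have := J_lt (φ := φ) (r := c') hc'; omega) h
          cases hp : (prev? φ r).isSome
          · rfl
          · rw [sF4, hp, Bool.and_true, decide_eq_false_iff_not] at h4; omega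
        · intro c' hc' h; have := d'Idx_lt hc'; have := le_rowCell (φ := φ) r (2 * (s + 1)); unfold blIdx at h; omega
        · intro r' c' _ hc' h; exact absurd h (blIdx_ne_wIdx (by omega) (J_lt hc'))
      · have h4' : s = J φ r r ∧ (prev? φ r).isSome = true := by simpa [sF4] using h4
        have Hset : ∀ {x y : RailV 2 4 4}, RailXOR.Γ.graph.Adj x y →
            (graph₂ φ).Adj (railNum (K := 4) (setBase φ r) (ends₂ (setSlots' φ r)) x) (railNum (K := 4) (setBase φ r) (ends₂ (setSlots' φ r)) y) :=
          fun hxy => adj₂_set hr hxy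
        obtain ⟨-, -, q1, q2⟩ := xor_ports Hset
        have e2 : (setSlots' φ r).2 = (5 * blIdx φ r (s + 1) + 3, 5 * blIdx φ r (s + 1) + 1) := by
          unfold setSlots'; rw [if_pos h4'.2, ← h4'.1, brIdx_eq]; rfl
        rw [e2] at q1 q2
        rintro (rfl | rfl) <;> simp only
        · rw [eN 1]; exact q2
        · rw [eN 3]; exact q1
  · -- the second rail of `h₀`
    obtain ⟨t, ht, rfl⟩ := mem_railE.1 he
    simp only [siteAnchor]
    have := xor_rail (φ := φ) 1 (by omega) ht (Hhop 0 (by omega))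
    rw [hb4] at this; convert this using 1 <;> omega
  · -- the rungs of `h₀`
    obtain ⟨t, ht, rfl⟩ := mem_rungE.1 he
    simp only [siteAnchor]
    have := xor_rung (φ := φ) 1 (by omega) ht (Hhop 0 (by omega))
    rw [hb4] at this; convert this using 1 <;> omega
  · -- the ports of `h₀` at `p₀, a₀`
    simp only [List.mem_cons, List.not_mem_nil, or_false] at he
    obtain ⟨-, -, q1, q2⟩ := xor_ports (Hhop 0 (by omega))
    have e2 : (hopSlots' φ (J φ r s) r 0).2 = (dlBase φ r s + 8, dlBase φ r s + 9) := by
      unfold hopSlots'; rw [if_pos rfl, hcs]; unfold hopUL; simp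
    rw [e2, hb4] at q1 q2
    rcases he with rfl | rfl <;> simp only [siteAnchor]
    · convert q1 using 1
    · convert q2 using 1
  · -- the hop ladders `h₁ … h₄` with their ports
    simp only [List.mem_flatMap, List.mem_range, List.mem_append, List.mem_cons, List.not_mem_nil, or_false] at he
    obtain ⟨h', hh', he⟩ := he
    have Hh : ∀ {x y : RailV 2 4 4}, RailXOR.Γ.graph.Adj x y →
        (graph₂ φ).Adj (railNum (K := 4) (hopBase φ (J φ r s) r (h' + 1)) (ends₂ (hopSlots' φ (J φ r s) r (h' + 1))) x)
          (railNum (K := 4) (hopBase φ (J φ r s) r (h' + 1)) (ends₂ (hopSlots' φ (J φ r s) r (h' + 1))) y) :=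
      fun hxy => Hhop (h' + 1) (by omega) hxy
    have e1 : (hopSlots' φ (J φ r s) r (h' + 1)).1 = (dlBase φ r s + (8 + 4 * h'), dlBase φ r s + (10 + 4 * h')) := by
      unfold hopSlots' hopSlots; rw [if_neg (by omega), if_neg (by omega), hcs]
      split_ifs with h4
      · obtain rfl : h' = 3 := by omega
        rfl
      · rw [Nat.add_sub_cancel]; rfl
    rcases he with ((((he | he) | he) | he) | he) | he
    · obtain ⟨t, ht, rfl⟩ := mem_railE.1 he
      simp only [siteAnchor]
      have := xor_rail (φ := φ) 0 (by omega) ht Hh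
      rw [hb4] at this; convert this using 1 <;> omega
    · obtain ⟨t, ht, rfl⟩ := mem_railE.1 he
      simp only [siteAnchor]
      have := xor_rail (φ := φ) 1 (by omega) ht Hh
      rw [hb4] at this; convert this using 1 <;> omega
    · obtain ⟨t, ht, rfl⟩ := mem_rungE.1 he
      simp only [siteAnchor]
      have := xor_rung (φ := φ) 0 (by omega) ht Hh
      rw [hb4] at this; convert this using 1 <;> omega
    · obtain ⟨t, ht, rfl⟩ := mem_rungE.1 he
      simp only [siteAnchor]
      have := xor_rung (φ := φ) 1 (by omega) ht Hh
      rw [hb4] at this; convert this using 1 <;> omega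
    · -- the first slot's ports: `p_{h'}, b_{h'}`
      obtain ⟨q1, q2, -, -⟩ := xor_ports Hh
      rw [e1, hb4] at q1 q2
      rcases he with rfl | rfl <;> simp only [siteAnchor]
      · convert q1 using 1; omega
      · convert q2 using 1; omega
    · -- the second slot's ports: `p_{h'+1}, a_{h'+1}`, or `p, a` of the door for `h₄`
      obtain ⟨-, -, q1, q2⟩ := xor_ports Hh
      by_cases h3 : h' < 3
      · rw [if_pos h3] at he; simp only [List.mem_cons, List.not_mem_nil, or_false] at he
        have e2 : (hopSlots' φ (J φ r s) r (h' + 1)).2 = (dlBase φ r s + (12 + 4 * h'), dlBase φ r s + (13 + 4 * h')) := by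
          unfold hopSlots' hopSlots; rw [if_neg (by omega), if_neg (by omega), if_neg (by omega), hcs]; unfold hopUL; simp only [Prod.mk.injEq]; omega
        rw [e2, hb4] at q1 q2
        rcases he with rfl | rfl <;> simp only [siteAnchor]
        · convert q1 using 1; omega
        · convert q2 using 1; omega
      · obtain rfl : h' = 3 := by omega
        rw [if_neg (lt_irrefl 3)] at he; simp only [List.mem_cons, List.not_mem_nil, or_false] at he
        have e2 : (hopSlots' φ (J φ r s) r (3 + 1)).2 = (5 * wIdx φ r s + 1, 5 * wIdx φ r s + 2) := by
          unfold hopSlots' hopSlots; rw [if_neg (by omega), if_neg (by omega), if_pos rfl, hcs]; rfl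
        rw [e2, hb4] at q1 q2
        rcases he with rfl | rfl <;> simp only [siteAnchor]
        · convert q1 using 1; omega
        · convert q2 using 1; omega
  · -- the first rail of the exit ladder
    obtain ⟨t, ht, rfl⟩ := mem_railE.1 he
    simp only [siteAnchor]
    split_ifs with h1
    · have := xor_rail (φ := φ) 0 (by omega) ht (fun hxy => adj₂_hop hJ h1 (h := 0) (by omega) hxy)
      rw [hb5 h1] at this; convert this using 1; omega
    · have := xor_rail (φ := φ) 0 (by omega) ht (fun hxy => adj₂_klink hJ hxy)
      rw [hk5] at this; convert this using 1; omega
  · -- the rungs of the exit ladder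
    obtain ⟨t, ht, rfl⟩ := mem_rungE.1 he
    simp only [siteAnchor]
    split_ifs with h1
    · have := xor_rung (φ := φ) 0 (by omega) ht (fun hxy => adj₂_hop hJ h1 (h := 0) (by omega) hxy)
      rw [hb5 h1] at this; convert this using 1
    · have := xor_rung (φ := φ) 0 (by omega) ht (fun hxy => adj₂_klink hJ hxy)
      rw [hk5] at this; convert this using 1
  · -- the ports of the exit ladder: `q, b` of `Bl` if the column taps here, else `b, p` of the door
    have hbelow : (below φ r (J φ r s)).swap = if sF3 φ r s = true then (5 * blIdx φ r s + 4, 5 * blIdx φ r s + 3)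
        else (5 * wIdx φ r s + 3, 5 * wIdx φ r s + 1) := by
      unfold below sF3; rw [hcs]
      by_cases ht : IsTap φ r (J φ r s)
      · rw [if_pos ht, if_pos (decide_eq_true ht)]; rfl
      · rw [if_neg ht, if_neg (by simpa using ht)]; rfl
    have key : (graph₂ φ).Adj (below φ r (J φ r s)).swap.1 (siteAnchor φ r s 5 + 0) ∧ (graph₂ φ).Adj (below φ r (J φ r s)).swap.2 (siteAnchor φ r s 5 + 3) := by
      simp only [siteAnchor]
      split_ifs with h1
      · obtain ⟨q1, q2, -, -⟩ := xor_ports (fun hxy => adj₂_hop hJ h1 (h := 0) (by omega) hxy)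
        have e1 : (hopSlots' φ (J φ r s) (r + 1) 0).1 = (below φ r (J φ r s)).swap := by unfold hopSlots' above; simp
        rw [e1, hb5 h1] at q1 q2
        exact ⟨by convert q1 using 1, by convert q2 using 1⟩
      · obtain ⟨q1, q2, -, -⟩ := xor_ports (fun hxy => adj₂_klink hJ hxy)
        have e1 : (klinkSlots' φ (J φ r s)).1 = (below φ r (J φ r s)).swap := by unfold klinkSlots'; rw [show N φ - 1 = r by omega]
        rw [e1, hk5] at q1 q2
        exact ⟨by convert q1 using 1, by convert q2 using 1⟩
    rw [hbelow] at key
    revert he key; cases h3 : sF3 φ r s <;> simp only [Bool.false_eq_true, if_false, if_true, List.mem_cons, List.not_mem_nil, or_false] <;>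
      rintro (rfl | rfl) ⟨k1, k2⟩ <;> simp only [siteAnchor] at k1 k2 ⊢
    · rw [show 5 * blIdx φ r s + 8 = 5 * wIdx φ r s + 3 by omega]; exact k1
    · rw [show 5 * blIdx φ r s + 6 = 5 * wIdx φ r s + 1 by omega]; exact k2
    · exact k1
    · exact k2
  · -- the set ladder's first rail with its ports at the door
    revert he; cases h4 : sF4 φ r s <;> simp only [Bool.false_eq_true, if_false, if_true, List.not_mem_nil, false_imp_iff, List.mem_append,
      List.mem_cons, or_false]
    have h4' : s = J φ r r ∧ (prev? φ r).isSome = true := by simpa [sF4] using h4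
    have Hset : ∀ {x y : RailV 2 4 4}, RailXOR.Γ.graph.Adj x y →
        (graph₂ φ).Adj (railNum (K := 4) (setBase φ r) (ends₂ (setSlots' φ r)) x) (railNum (K := 4) (setBase φ r) (ends₂ (setSlots' φ r)) y) :=
      fun hxy => adj₂_set hr hxy
    rintro ((he | he) | rfl | rfl)
    · obtain ⟨t, ht, rfl⟩ := mem_railE.1 he
      simp only [siteAnchor]
      have := xor_rail (φ := φ) 0 (by omega) ht Hset
      convert this using 1; omega
    · obtain ⟨t, ht, rfl⟩ := mem_rungE.1 he
      simp only [siteAnchor]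
      have := xor_rung (φ := φ) 0 (by omega) ht Hset
      convert this using 1
    · obtain ⟨q1, -, -, -⟩ := xor_ports Hset
      have e1 : (setSlots' φ r).1 = (5 * wIdx φ r s + 1, 5 * wIdx φ r s + 3) := by unfold setSlots'; rw [if_pos h4'.2, ← h4'.1]; rfl
      rw [e1] at q1
      simp only [siteAnchor]; rw [show 5 * blIdx φ r s + 6 = 5 * wIdx φ r s + 1 by omega]; exact q1
    · obtain ⟨-, q2, -, -⟩ := xor_ports Hset
      have e1 : (setSlots' φ r).1 = (5 * wIdx φ r s + 1, 5 * wIdx φ r s + 3) := by unfold setSlots'; rw [if_pos h4'.2, ← h4'.1]; rfl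
      rw [e1] at q2
      simp only [siteAnchor]; rw [show 5 * blIdx φ r s + 8 = 5 * wIdx φ r s + 3 by omega]; exact q2
  · -- the set ladder's second rail
    revert he
    cases h54 : (sF5 φ r s || sF4 φ r s && sF2 φ s) <;> simp only [Bool.false_eq_true, if_false, if_true, List.not_mem_nil, false_imp_iff,
      List.mem_append]
    have Hset : ∀ {x y : RailV 2 4 4}, RailXOR.Γ.graph.Adj x y →
        (graph₂ φ).Adj (railNum (K := 4) (setBase φ r) (ends₂ (setSlots' φ r)) x) (railNum (K := 4) (setBase φ r) (ends₂ (setSlots' φ r)) y) :=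
      fun hxy => adj₂_set hr hxy
    rintro (he | he)
    · obtain ⟨t, ht, rfl⟩ := mem_railE.1 he
      simp only [siteAnchor]
      have := xor_rail (φ := φ) 1 (by omega) ht Hset
      convert this using 1; omega
    · obtain ⟨t, ht, rfl⟩ := mem_rungE.1 he
      simp only [siteAnchor]
      have := xor_rung (φ := φ) 1 (by omega) ht Hset
      convert this using 1
  · -- the ports of the set ladder's second rail at `Bl`
    revert he; cases h5 : sF5 φ r s <;> simp only [Bool.false_eq_true, if_false, if_true, List.not_mem_nil, false_imp_iff, List.mem_cons, or_false]
    have h5' : (1 ≤ s ∧ s - 1 = J φ r r) ∧ (prev? φ r).isSome = true := by simpa [sF5] using h5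
    have Hset : ∀ {x y : RailV 2 4 4}, RailXOR.Γ.graph.Adj x y →
        (graph₂ φ).Adj (railNum (K := 4) (setBase φ r) (ends₂ (setSlots' φ r)) x) (railNum (K := 4) (setBase φ r) (ends₂ (setSlots' φ r)) y) :=
      fun hxy => adj₂_set hr hxy
    obtain ⟨-, -, q1, q2⟩ := xor_ports Hset
    have e2 : (setSlots' φ r).2 = (5 * blIdx φ r s + 3, 5 * blIdx φ r s + 1) := by
      unfold setSlots'; rw [if_pos h5'.2, brIdx_eq, show J φ r r + 1 = s by omega]; rfl
    rw [e2] at q1 q2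
    rintro (rfl | rfl) <;> simp only [siteAnchor]
    exacts [q1, q2]

/-! ### Every expected key pair of a dummy pair is an edge of the gadget graph -/

/-- **Every expected key pair of a dummy-pair tile is an edge of `graph₂`.** [folklore] -/
theorem dummyEdges_adj (hN : 0 < N φ) {c : ℕ} (hc : c < N φ) :
    ∀ e ∈ dummyEdges (decide (c + 1 = N φ)) (prev? φ c).isNone,
      (graph₂ φ).Adj ((PD.dummy c).ν φ e.1) ((PD.dummy c).ν φ e.2) := by
  intro e he
  have hM : 2 * c + 1 < M φ := by unfold M; omega
  have hM' : 2 * c + 2 < M φ := by unfold M; omega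
  have h5 := five_cell_lt_base1 φ hM'
  have hrow : ∀ r k, 2 * N φ ≤ rowCell φ r k := le_rowCell (φ := φ)
  have hK : ∀ c', 2 * N φ ≤ kIdx φ c' := fun c' => by unfold kIdx; omega
  have hpin : base1 φ + 24 * (N φ * N φ) ≤ pinBase φ (2 * c) := by unfold pinBase; omega
  have ed : ∀ d, 5 * (2 * c) + (5 + d) = 5 * (2 * c + 1) + d := fun d => by omega
  -- the first hop ladder of the column and the vacuous set ladder
  have Hhop : ∀ {x y : RailV 2 4 4}, RailXOR.Γ.graph.Adj x y →
      (graph₂ φ).Adj (railNum (K := 4) (hopBase φ c 0 0) (ends₂ (hopSlots' φ c 0 0)) x) (railNum (K := 4) (hopBase φ c 0 0) (ends₂ (hopSlots' φ c 0 0)) y) :=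
    fun hxy => adj₂_hop hc hN (h := 0) (by omega) hxy
  have hb : hopBase φ c 0 0 = base2 φ + 60 * (c * N φ) := by unfold hopBase; ring
  have Hset : ∀ {x y : RailV 2 4 4}, RailXOR.Γ.graph.Adj x y →
      (graph₂ φ).Adj (railNum (K := 4) (setBase φ c) (ends₂ (setSlots' φ c)) x) (railNum (K := 4) (setBase φ c) (ends₂ (setSlots' φ c)) y) :=
    fun hxy => adj₂_set hc hxy
  have Hpin : ∀ d, d = 2 * c ∨ d = 2 * c + 1 → ∀ {x y : RailV 1 2 1}, RailOR1.Γ.graph.Adj x y →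
      (graph₂ φ).Adj (railNum (K := 2) (pinBase φ d) (fun _ => slUL d) x) (railNum (K := 2) (pinBase φ d) (fun _ => slUL d) y) := by
    intro d hd x y hxy
    refine adj₂_pin (by omega) hxy ?_
    have hp : base1 φ + 24 * (N φ * N φ) ≤ pinBase φ d := by unfold pinBase; omega
    have h5' : 5 * d + 4 < base1 φ := five_cell_lt_base1 φ (by unfold M; omega)
    cases x with
    | node u => exact not_SB₂_high (by show _ ≤ pinBase φ d + _; omega)
    | mid ρ => exact not_SB₂_high (by show _ ≤ pinBase φ d + _; omega)
    | port u t =>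
      cases y with
      | node u' => cases t <;> exact not_SB₂_mixed (by unfold railNum slUL; simp only; omega) (by show _ ≤ pinBase φ d + _; omega)
      | mid ρ => cases t <;> exact not_SB₂_mixed (by unfold railNum slUL; simp only; omega) (by show _ ≤ pinBase φ d + _; omega)
      | port u' t' =>
        exfalso; rw [RailGadget.graph] at hxy
        cases t <;> cases t' <;> exact hxy.2.elim (fun h => by simp [RailGadget.relB] at h) (fun h => by simp [RailGadget.relB] at h)
  obtain ⟨pa, pb, pc, pd, pe⟩ := RailOR1.adj_all
  simp only [dummyEdges, List.mem_append] at he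
  simp only [PD.ν]
  rcases he with ((((((he | he) | he) | he) | he) | he) | he) | he
  · -- chain edges always present
    simp only [List.mem_cons, List.not_mem_nil, or_false] at he
    rcases he with rfl | rfl | rfl | rfl | rfl | rfl | rfl | rfl <;> simp only [dummyAnchor]
    · exact adj₂_chain (by omega) (by omega) (notSlot_cp hN (by omega))
    · exact adj₂_chain (by omega) (by omega) (notSlot_ab hN (by omega))
    · exact adj₂_chain (by omega) (by omega) (notSlot_UR hN (by omega) (fun r j _ _ h => by have := hrow r (2 * j); unfold blIdx at h; omega))
    · exact adj₂_chain (by omega) (by omega) (notSlot_qc hN (by omega))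
    · rw [show 5 * (2 * c) + 5 = 5 * (2 * c + 1) by omega, ed 1]; exact adj₂_chain (by omega) (by omega) (notSlot_cp hN hM)
    · rw [ed 2, ed 3]; exact adj₂_chain (by omega) (by omega) (notSlot_ab hN hM)
    · rw [ed 2, ed 4]
      exact adj₂_chain (by omega) (by omega) (notSlot_UR hN hM (fun r j _ _ h => by have := hrow r (2 * j); unfold blIdx at h; omega))
    · rw [ed 3, ed 4]
      refine adj₂_chain (by omega) (by omega) (notSlot_LR hN hM ?_ ?_ ?_)
      · intro c' _ h; have := hK c'; omega
      · intro c' _ h; unfold dIdx at h; omega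
      · intro r c' _ _ h; have := hrow r (2 * J φ r c'); unfold blIdx at h; omega
  · -- `D.b – D.q` and `D'.p – D'.b` when the set ladder is not vacuous
    revert he; cases hv : (prev? φ c).isNone <;> simp only [Bool.false_eq_true, if_false, if_true, List.not_mem_nil, false_imp_iff,
      List.mem_cons, or_false]
    have hsome : (prev? φ c).isSome = true := by cases h : prev? φ c <;> simp_all
    rintro (rfl | rfl) <;> simp only [dummyAnchor]
    · refine adj₂_chain (by omega) (by omega) (notSlot_LR hN (by omega) ?_ ?_ ?_)
      · intro c' _ h; have := hK c'; omega
      · intro c' _ h; unfold dIdx at h; rw [show c' = c by omega]; exact hsome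
      · intro r c' _ _ h; have := hrow r (2 * J φ r c'); unfold blIdx at h; omega
    · rw [ed 1, ed 3]
      refine adj₂_chain (by omega) (by omega) (notSlot_LL hN hM ?_ ?_ ?_ ?_ ?_ ?_)
      · intro c' _ h; have := hK c'; omega
      · intro c' _ h; have := hrow c' (2 * J φ c' c' + 1); unfold wIdx at h; omega
      · intro c' _ h; unfold dIdx at h; omega
      · intro c' _ h; have := hrow c' (2 * J φ c' c' + 2); unfold brIdx at h; omega
      · intro c' _ h; unfold d'Idx at h; rw [show c' = c by omega]; exact hsome
      · intro r c' _ _ h; have := hrow r (2 * J φ r c' + 1); unfold wIdx at h; omega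
  · -- the connector to the next dummy pair, or to the first cell of row `0`
    revert he; cases hl : decide (c + 1 = N φ) <;> simp only [Bool.false_eq_true, if_false, if_true, List.mem_singleton]
    · rintro rfl; simp only [dummyAnchor]
      rw [ed 4, ed 5]; exact adj₂_chain (by omega) (by omega) (notSlot_qc hN hM')
    · rintro rfl; simp only [dummyAnchor]
      have hcN : c + 1 = N φ := by simpa using hl
      rw [ed 4, show 5 * blIdx φ 0 0 + 0 = 5 * (2 * c + 1) + 5 by unfold blIdx rowCell rowStart; omega]
      exact adj₂_chain (by omega) (by omega) (notSlot_qc hN hM')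
  · -- the pins with their ports
    simp only [List.mem_cons, List.not_mem_nil, or_false] at he
    have H0 : ∀ {x y : RailV 1 2 1}, RailOR1.Γ.graph.Adj x y →
        (graph₂ φ).Adj (railNum (K := 2) (pinBase φ (2 * c)) (fun _ => slUL (2 * c)) x) (railNum (K := 2) (pinBase φ (2 * c)) (fun _ => slUL (2 * c)) y) :=
      fun hxy => Hpin (2 * c) (Or.inl rfl) hxy
    have H1 : ∀ {x y : RailV 1 2 1}, RailOR1.Γ.graph.Adj x y →
        (graph₂ φ).Adj (railNum (K := 2) (pinBase φ (2 * c + 1)) (fun _ => slUL (2 * c + 1)) x)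
          (railNum (K := 2) (pinBase φ (2 * c + 1)) (fun _ => slUL (2 * c + 1)) y) :=
      fun hxy => Hpin (2 * c + 1) (Or.inr rfl) hxy
    rcases he with rfl | rfl | rfl | rfl | rfl | rfl | rfl | rfl | rfl | rfl <;> simp only [dummyAnchor]
    · exact H0 pa
    · exact H0 pb
    · exact H0 pc
    · rw [show pinBase φ (2 * c) + 3 = pinBase φ (2 * c + 1) + (0 * 2 + 0) by rw [pinBase_succ],
        show pinBase φ (2 * c) + 4 = pinBase φ (2 * c + 1) + (0 * 2 + 1) by rw [pinBase_succ]]; exact H1 pa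
    · rw [show pinBase φ (2 * c) + 3 = pinBase φ (2 * c + 1) + (0 * 2 + 0) by rw [pinBase_succ],
        show pinBase φ (2 * c) + 5 = pinBase φ (2 * c + 1) + (1 * 2 + 0) by rw [pinBase_succ]]; exact H1 pb
    · rw [show pinBase φ (2 * c) + 4 = pinBase φ (2 * c + 1) + (0 * 2 + 1) by rw [pinBase_succ],
        show pinBase φ (2 * c) + 5 = pinBase φ (2 * c + 1) + (1 * 2 + 0) by rw [pinBase_succ]]; exact H1 pc
    · exact H0 pd
    · exact H0 pe
    · rw [ed 1, show pinBase φ (2 * c) + 3 = pinBase φ (2 * c + 1) + (0 * 2 + 0) by rw [pinBase_succ]]; exact H1 pd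
    · rw [ed 2, show pinBase φ (2 * c) + 4 = pinBase φ (2 * c + 1) + (0 * 2 + 1) by rw [pinBase_succ]]; exact H1 pe
  · -- the first rail of `h₀` of the column
    obtain ⟨t, ht, rfl⟩ := mem_railE.1 he
    simp only [dummyAnchor]
    have := xor_rail (φ := φ) 0 (by omega) ht Hhop
    rw [hb] at this; convert this using 1; omega
  · obtain ⟨t, ht, rfl⟩ := mem_rungE.1 he
    simp only [dummyAnchor]
    have := xor_rung (φ := φ) 0 (by omega) ht Hhop
    rw [hb] at this; convert this using 1
  · -- its ports at `D.b, D.p`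
    simp only [List.mem_cons, List.not_mem_nil, or_false] at he
    obtain ⟨q1, q2, -, -⟩ := xor_ports Hhop
    have e1 : (hopSlots' φ c 0 0).1 = (5 * (2 * c) + 3, 5 * (2 * c) + 1) := by unfold hopSlots' above; simp [slLL, dIdx]
    rw [e1, hb] at q1 q2
    rcases he with rfl | rfl <;> simp only [dummyAnchor]
    · convert q1 using 1
    · convert q2 using 1
  · -- the vacuous set ladder with its ports
    revert he; cases hv : (prev? φ c).isNone <;> simp only [Bool.false_eq_true, if_false, if_true, List.not_mem_nil, false_imp_iff,
      List.mem_append, List.mem_cons, or_false]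
    have hnone : (prev? φ c).isSome = false := by cases h : prev? φ c <;> simp_all
    have e12 : setSlots' φ c = ((5 * (2 * c) + 3, 5 * (2 * c) + 4), (5 * (2 * c) + 8, 5 * (2 * c) + 6)) := by
      unfold setSlots'; rw [if_neg (by rw [hnone]; exact Bool.false_ne_true)]; simp [slLR, slLL, dIdx, d'Idx]; omega
    obtain ⟨q1, q2, q3, q4⟩ := xor_ports Hset
    rw [e12] at q1 q2 q3 q4
    rintro ((((he | he) | he) | he) | rfl | rfl | rfl | rfl) <;> try simp only [dummyAnchor]
    · obtain ⟨t, ht, rfl⟩ := mem_railE.1 he; simp only; exact xor_rail (φ := φ) 0 (by omega) ht Hset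
    · obtain ⟨t, ht, rfl⟩ := mem_railE.1 he; simp only
      have := xor_rail (φ := φ) 1 (by omega) ht Hset; convert this using 1; omega
    · obtain ⟨t, ht, rfl⟩ := mem_rungE.1 he; simp only; exact xor_rung (φ := φ) 0 (by omega) ht Hset
    · obtain ⟨t, ht, rfl⟩ := mem_rungE.1 he; simp only
      have := xor_rung (φ := φ) 1 (by omega) ht Hset; convert this using 1
    · exact q1
    · exact q2
    · exact q3
    · exact q4

/-! ### Every expected key pair of the clause row is an edge of the gadget graph -/

/-- **The expected key pairs of a clause cell `K_c`** (chain edges, literal ports, clause link with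
its ports), for any numbering `nu` of the keys that puts the cell's keys `(0, b + d)` at
`5 · K_c + d`, the link's keys `(1, m + d)` at `klinkBase c + 4 + d`, and the gadget ports `g₁, g₂`
at gadget vertices joined to the literal slot's ends. [folklore] -/
theorem kcellEdges_adj (hN : 0 < N φ) (hN3 : N φ = 3 * T φ + 1) {c : ℕ} (hc : c < N φ) {b m : ℕ} {g₁ g₂ : ℕ × ℕ}
    {nu : ℕ × ℕ → ℕ} (h0 : ∀ d ≤ 5, nu (0, b + d) = 5 * kIdx φ c + d) (h1 : ∀ d < 8, nu (1, m + d) = klinkBase φ c + 4 + d)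
    (hg₁ : (graph₂ φ).Adj (litSlot φ c).1 (nu g₁)) (hg₂ : (graph₂ φ).Adj (litSlot φ c).2 (nu g₂)) :
    ∀ e ∈ kcellEdges b (FormulaCells.polOf φ c) g₁ g₂ m, (graph₂ φ).Adj (nu e.1) (nu e.2) := by
  intro e he
  have hkM : kIdx φ c < M φ := kIdx_lt_M hc
  have hk1M : kIdx φ c + 1 < M φ := by have := zIdx_lt (φ := φ); unfold kIdx at *; unfold zIdx at this; omega
  have h5 := five_cell_lt_base1 φ hkM
  have hrowK : ∀ r k, r < N φ → k ≤ 2 * N φ → rowCell φ r k < kIdx φ c := fun r k hr hk =>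
    lt_of_lt_of_le (rowCell_lt hr hk) (by unfold kIdx; omega)
  have hdK : ∀ c', c' < N φ → d'Idx c' < kIdx φ c := fun c' hc' => by have := d'Idx_lt hc'; unfold kIdx; omega
  have hKinj : ∀ c', kIdx φ c = kIdx φ c' → c' = c := fun c' h => by unfold kIdx at h; omega
  have Hkl : ∀ {x y : RailV 2 4 4}, RailXOR.Γ.graph.Adj x y →
      (graph₂ φ).Adj (railNum (K := 4) (klinkBase φ c) (ends₂ (klinkSlots' φ c)) x) (railNum (K := 4) (klinkBase φ c) (ends₂ (klinkSlots' φ c)) y) :=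
    fun hxy => adj₂_klink hc hxy
  have e2 : (klinkSlots' φ c).2 = (5 * kIdx φ c + 1, 5 * kIdx φ c + 2) := rfl
  have hb0 := h0 0 (by omega); have hb1 := h0 1 (by omega); have hb2 := h0 2 (by omega); have hb3 := h0 3 (by omega)
  have hb4 := h0 4 (by omega); have hb5 := h0 5 (by omega)
  rw [Nat.add_zero] at hb0
  unfold kcellEdges at he
  simp only [List.mem_append, List.mem_cons, List.not_mem_nil, or_false] at he
  rcases he with (((he | he) | he) | he) | he
  · rcases he with rfl | rfl | rfl | rfl
    · show (graph₂ φ).Adj (nu (0, b)) (nu (0, b + 1))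
      rw [hb0, hb1]; exact adj₂_chain (by omega) (by omega) (notSlot_cp hN hkM)
    · show (graph₂ φ).Adj (nu (0, b + 2)) (nu (0, b + 3))
      rw [hb2, hb3]; exact adj₂_chain (by omega) (by omega) (notSlot_ab hN hkM)
    · show (graph₂ φ).Adj (nu (0, b + 2)) (nu (0, b + 4))
      rw [hb2, hb4]
      exact adj₂_chain (by omega) (by omega) (notSlot_UR hN hkM (fun r j hr hj h => by have := hrowK r (2 * j) hr (by omega); unfold blIdx at h; omega))
    · show (graph₂ φ).Adj (nu (0, b + 4)) (nu (0, b + 5))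
      rw [hb4, hb5]; exact adj₂_chain (by omega) (by omega) (notSlot_qc hN hk1M)
  · revert he
    cases hp : FormulaCells.polOf φ c <;> simp only [Bool.false_eq_true, if_false, if_true, List.mem_cons, List.not_mem_nil, or_false]
    · -- negative literal: `p b` stays, the literal slot is `b q`
      have hl : litSlot φ c = (5 * kIdx φ c + 3, 5 * kIdx φ c + 4) := by unfold litSlot; rw [hp]; rfl
      rw [hl] at hg₁ hg₂
      rintro (rfl | rfl | rfl)
      · show (graph₂ φ).Adj (nu (0, b + 1)) (nu (0, b + 3))
        rw [hb1, hb3]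
        refine adj₂_chain (by omega) (by omega) (notSlot_LL hN hkM ?_ ?_ ?_ ?_ ?_ ?_)
        · intro c' _ h; rw [hKinj c' h]; exact hp
        · intro c' hc' h; have := hrowK c' (2 * J φ c' c' + 1) hc' (by have := J_lt (φ := φ) (r := c') hc'; omega); unfold wIdx at h; omega
        · intro c' hc' h; have := dIdx_lt hc'; unfold kIdx at h; omega
        · intro c' hc' h; have := hrowK c' (2 * J φ c' c' + 2) hc' (by have := J_lt (φ := φ) (r := c') hc'; omega); unfold brIdx at h; omega
        · intro c' hc' h; have := hdK c' hc'; omega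
        · intro r c' hr hc' h; have := hrowK r (2 * J φ r c' + 1) hr (by have := J_lt (φ := φ) (r := r) hc'; omega); unfold wIdx at h; omega
      · show (graph₂ φ).Adj (nu (0, b + 3)) (nu g₁); rw [hb3]; exact hg₁
      · show (graph₂ φ).Adj (nu (0, b + 4)) (nu g₂); rw [hb4]; exact hg₂
    · have hl : litSlot φ c = (5 * kIdx φ c + 1, 5 * kIdx φ c + 3) := by unfold litSlot; rw [hp]; rfl
      rw [hl] at hg₁ hg₂
      rintro (rfl | rfl | rfl)
      · show (graph₂ φ).Adj (nu (0, b + 3)) (nu (0, b + 4))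
        rw [hb3, hb4]
        refine adj₂_chain (by omega) (by omega) (notSlot_LR hN hkM ?_ ?_ ?_)
        · intro c' _ h; rw [hKinj c' h]; exact hp
        · intro c' hc' h; have := dIdx_lt hc'; unfold kIdx at h; omega
        · intro r c' hr hc' h; have := hrowK r (2 * J φ r c') hr (by have := J_lt (φ := φ) (r := r) hc'; omega); unfold blIdx at h; omega
      · show (graph₂ φ).Adj (nu (0, b + 1)) (nu g₁); rw [hb1]; exact hg₁
      · show (graph₂ φ).Adj (nu (0, b + 3)) (nu g₂); rw [hb3]; exact hg₂
  · obtain ⟨t, ht, rfl⟩ := mem_railE.1 he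
    show (graph₂ φ).Adj (nu (1, m + t)) (nu (1, m + t + 1))
    rw [h1 t (by omega), show m + t + 1 = m + (t + 1) by omega, h1 (t + 1) (by omega)]
    have := xor_rail (φ := φ) 1 (by omega) ht Hkl; convert this using 1 <;> omega
  · obtain ⟨t, ht, rfl⟩ := mem_rungE.1 he
    show (graph₂ φ).Adj (nu (1, m + t)) (nu (1, m + 4 + t))
    rw [h1 t (by omega), show m + 4 + t = m + (4 + t) by omega, h1 (4 + t) (by omega)]
    have := xor_rung (φ := φ) 1 (by omega) ht Hkl; convert this using 1 <;> omega
  · obtain ⟨-, -, q1, q2⟩ := xor_ports Hkl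
    rw [e2] at q1 q2
    rcases he with rfl | rfl
    · show (graph₂ φ).Adj (nu (0, b + 1)) (nu (1, m)); rw [hb1, show m = m + 0 by rfl, h1 0 (by omega)]; exact q1
    · show (graph₂ φ).Adj (nu (0, b + 2)) (nu (1, m + 3)); rw [hb2, h1 3 (by omega)]; exact q2

/-- Codes of the rung ends of the three-input OR-gadget (by `decide`). [folklore] -/
theorem or3Rungs_spec : ∀ ρ : Fin 9, ((RailOR3.fst ρ).1.val * 6 + (RailOR3.fst ρ).2.val, (RailOR3.snd ρ).1.val * 6 + (RailOR3.snd ρ).2.val) =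
    or3Rungs.getD ρ.val (0, 0) := by decide

/-- **Every expected key pair of the tile of `K_0` is an edge of `graph₂`.** [folklore] -/
theorem k0Edges_adj (hN : 0 < N φ) (hN3 : N φ = 3 * T φ + 1) :
    ∀ e ∈ k0Edges (FormulaCells.polOf φ 0), (graph₂ φ).Adj (PD.k0.ν φ e.1) (PD.k0.ν φ e.2) := by
  have hcb : base1 φ + 24 * (N φ * N φ) ≤ clause1Base φ := by unfold clause1Base; omega
  have h5 := five_cell_lt_base1 φ (kIdx_lt_M (φ := φ) (c := 0) hN)
  have Hcl : ∀ {x y : RailV 1 2 1}, RailOR1.Γ.graph.Adj x y →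
      (graph₂ φ).Adj (railNum (K := 2) (clause1Base φ) (fun _ => litSlot φ 0) x) (railNum (K := 2) (clause1Base φ) (fun _ => litSlot φ 0) y) := by
    intro x y hxy
    refine adj₂_cl1 hxy ?_
    have hl : (litSlot φ 0).1 < base1 φ ∧ (litSlot φ 0).2 < base1 φ := by unfold litSlot; split_ifs <;> [unfold slLL; unfold slLR] <;> simp only <;> omega
    cases x with
    | node u => exact not_SB₂_high (by show _ ≤ clause1Base φ + _; omega)
    | mid ρ => exact not_SB₂_high (by show _ ≤ clause1Base φ + _; omega)
    | port u t =>
      cases y with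
      | node u' => cases t <;> exact not_SB₂_mixed (by simp only [railNum]; omega) (by show _ ≤ clause1Base φ + _; omega)
      | mid ρ => cases t <;> exact not_SB₂_mixed (by simp only [railNum]; omega) (by show _ ≤ clause1Base φ + _; omega)
      | port u' t' =>
        exfalso; rw [RailGadget.graph] at hxy
        cases t <;> cases t' <;> exact hxy.2.elim (fun h => by simp [RailGadget.relB] at h) (fun h => by simp [RailGadget.relB] at h)
  obtain ⟨pa, pb, pc, pd, pe⟩ := RailOR1.adj_all
  intro e he
  unfold k0Edges at he
  rw [List.mem_append] at he
  rcases he with he | he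
  · exact kcellEdges_adj hN hN3 hN (nu := PD.k0.ν φ) (g₁ := (2, 0)) (g₂ := (2, 1)) (fun d _ => by simp [PD.ν, k0Anchor])
      (fun d _ => by simp only [PD.ν, k0Anchor]; omega) (by simpa [railNum, PD.ν, k0Anchor] using Hcl pd)
      (by simpa [railNum, PD.ν, k0Anchor] using Hcl pe) e he
  · simp only [List.mem_cons, List.not_mem_nil, or_false] at he
    rcases he with rfl | rfl | rfl <;> simp only [PD.ν, k0Anchor]
    exacts [Hcl pa, Hcl pb, Hcl pc]

/-- **Every expected key pair of a clause tile is an edge of `graph₂`.** [folklore] -/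
theorem clauseEdges_adj (hN : 0 < N φ) (hN3 : N φ = 3 * T φ + 1) {t : ℕ} (ht : t < T φ) :
    ∀ e ∈ clauseEdges (cPols φ t).1 (cPols φ t).2.1 (cPols φ t).2.2, (graph₂ φ).Adj ((PD.clause t).ν φ e.1) ((PD.clause t).ν φ e.2) := by
  have hob : base1 φ + 24 * (N φ * N φ) ≤ or3Base φ t := by unfold or3Base clause1Base; omega
  have Hor : ∀ {x y : RailV 3 6 9}, RailOR3.Γ.graph.Adj x y →
      (graph₂ φ).Adj (railNum (K := 6) (or3Base φ t) (fun r => litSlot φ (3 * t + 1 + r.val)) x)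
        (railNum (K := 6) (or3Base φ t) (fun r => litSlot φ (3 * t + 1 + r.val)) y) := by
    intro x y hxy
    refine adj₂_or3 ht hxy ?_
    have hl : ∀ u : Fin 3, (litSlot φ (3 * t + 1 + u.val)).1 < base1 φ ∧ (litSlot φ (3 * t + 1 + u.val)).2 < base1 φ := fun u => by
      have := five_cell_lt_base1 φ (kIdx_lt_M (φ := φ) (c := 3 * t + 1 + u.val) (by have := u.isLt; omega))
      unfold litSlot; split_ifs <;> [unfold slLL; unfold slLR] <;> simp only <;> omega
    cases x with
    | node u => exact not_SB₂_high (by show _ ≤ or3Base φ t + _; omega)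
    | mid ρ => exact not_SB₂_high (by show _ ≤ or3Base φ t + _; omega)
    | port u b =>
      have := hl u
      cases y with
      | node u' => cases b <;> exact not_SB₂_mixed (by simp only [railNum]; omega) (by show _ ≤ or3Base φ t + _; omega)
      | mid ρ => cases b <;> exact not_SB₂_mixed (by simp only [railNum]; omega) (by show _ ≤ or3Base φ t + _; omega)
      | port u' b' =>
        exfalso; rw [RailGadget.graph] at hxy
        cases b <;> cases b' <;> exact hxy.2.elim (fun h => by simp [RailGadget.relB] at h) (fun h => by simp [RailGadget.relB] at h)
  -- each of the three cells
  have Hcell : ∀ u < 3, ∀ e ∈ kcellEdges (5 * u) (FormulaCells.polOf φ (3 * t + 1 + u)) (2, 6 * u) (2, 6 * u + 5) (12 * u + 4),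
      (graph₂ φ).Adj ((PD.clause t).ν φ e.1) ((PD.clause t).ν φ e.2) := by
    intro u hu
    have hp := RailOR3.adj_port ⟨u, hu⟩
    refine kcellEdges_adj hN hN3 (c := 3 * t + 1 + u) (by omega) (fun d _ => ?_) (fun d _ => ?_) ?_ ?_
    · simp only [PD.ν, clauseAnchor]; unfold kIdx; omega
    · simp only [PD.ν, clauseAnchor]; unfold klinkBase; omega
    · have := Hor hp.1; simp only [railNum] at this; simp only [PD.ν, clauseAnchor]; convert this using 1; omega
    · have := Hor hp.2; simp only [railNum] at this; simp only [PD.ν, clauseAnchor]; convert this using 1; omega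
  intro e he
  unfold clauseEdges at he
  simp only [List.mem_append, List.mem_flatMap, List.mem_range, List.mem_cons, List.not_mem_nil, or_false] at he
  rcases he with (((((he | he) | he) | he) | he) | he) | ⟨ρ, hρ, he⟩
  · exact Hcell 0 (by omega) e he
  · exact Hcell 1 (by omega) e he
  · exact Hcell 2 (by omega) e he
  · obtain ⟨t', ht', rfl⟩ := mem_railE.1 he; simp only [PD.ν, clauseAnchor]
    have := Hor (RailOR3.adj_rail 0 ⟨t', by omega⟩ ⟨t' + 1, by omega⟩ rfl)
    simp only [railNum, Fin.val_zero] at this; convert this using 1; omega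
  · obtain ⟨t', ht', rfl⟩ := mem_railE.1 he; simp only [PD.ν, clauseAnchor]
    have := Hor (RailOR3.adj_rail 1 ⟨t', by omega⟩ ⟨t' + 1, by omega⟩ rfl)
    simp only [railNum, Fin.val_one] at this; convert this using 1; omega
  · obtain ⟨t', ht', rfl⟩ := mem_railE.1 he; simp only [PD.ν, clauseAnchor]
    have := Hor (RailOR3.adj_rail 2 ⟨t', by omega⟩ ⟨t' + 1, by omega⟩ rfl)
    simp only [railNum, Fin.val_two] at this; convert this using 1; omega
  · have hspec := or3Rungs_spec ⟨ρ, hρ⟩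
    obtain ⟨hr1, hr2⟩ := RailOR3.adj_rung ⟨ρ, hρ⟩
    rw [← hspec] at he
    rcases he with rfl | rfl <;> simp only [PD.ν, clauseAnchor]
    · have := Hor hr1; simp only [railNum] at this; convert this using 1
    · have := Hor hr2; simp only [railNum] at this; convert this using 1

/-- **Every expected key pair of the end tile is an edge of `graph₂`.** [folklore] -/
theorem zEdges_adj (hN : 0 < N φ) : ∀ e ∈ zEdges, (graph₂ φ).Adj (PD.z.ν φ e.1) (PD.z.ν φ e.2) := by
  intro e he
  have hzM := zIdx_lt (φ := φ)
  have hrowZ : ∀ r k, r < N φ → k ≤ 2 * N φ → rowCell φ r k < zIdx φ := fun r k hr hk => lt_of_lt_of_le (rowCell_lt hr hk) (by unfold zIdx; omega)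
  have hKZ : ∀ c', c' < N φ → kIdx φ c' < zIdx φ := fun c' hc' => kIdx_lt hc'
  unfold zEdges at he
  simp only [List.mem_cons, List.not_mem_nil, or_false] at he
  rcases he with rfl | rfl | rfl | rfl | rfl | rfl <;> simp only [PD.ν]
  · exact adj₂_chain (by omega) (by omega) (notSlot_cp hN hzM)
  · refine adj₂_chain (by omega) (by omega) (notSlot_UL hN hzM (by unfold zIdx; omega) ?_ ?_ ?_)
    · intro r j hr hj h; have := hrowZ r (2 * j + 2) hr (by omega); unfold brIdx at h; omega
    · intro r j hr hj h; have := hrowZ r (2 * j + 1) hr (by omega); unfold wIdx at h; omega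
    · intro c' hc' h; have := hKZ c' hc'; omega
  · refine adj₂_chain (by omega) (by omega) (notSlot_LL hN hzM ?_ ?_ ?_ ?_ ?_ ?_)
    · intro c' hc' h; have := hKZ c' hc'; omega
    · intro c' hc' h; have := hrowZ c' (2 * J φ c' c' + 1) hc' (by have := J_lt (φ := φ) (r := c') hc'; omega); unfold wIdx at h; omega
    · intro c' hc' h; have := dIdx_lt hc'; unfold zIdx at h; omega
    · intro c' hc' h; have := hrowZ c' (2 * J φ c' c' + 2) hc' (by have := J_lt (φ := φ) (r := c') hc'; omega); unfold brIdx at h; omega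
    · intro c' hc' h; have := d'Idx_lt hc'; unfold zIdx at h; omega
    · intro r c' hr hc' h; have := hrowZ r (2 * J φ r c' + 1) hr (by have := J_lt (φ := φ) (r := r) hc'; omega); unfold wIdx at h; omega
  · exact adj₂_chain (by omega) (by omega) (notSlot_ab hN hzM)
  · exact adj₂_chain (by omega) (by omega) (notSlot_UR hN hzM (fun r j hr hj h => by have := hrowZ r (2 * j) hr (by omega); unfold blIdx at h; omega))
  · refine adj₂_chain (by omega) (by omega) (notSlot_LR hN hzM ?_ ?_ ?_)
    · intro c' hc' h; have := hKZ c' hc'; omega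
    · intro c' hc' h; have := dIdx_lt hc'; unfold zIdx at h; omega
    · intro r c' hr hc' h; have := hrowZ r (2 * J φ r c') hr (by have := J_lt (φ := φ) (r := r) hc'; omega); unfold blIdx at h; omega

/-! ### Every local edge of every placed tile is an edge of the gadget graph -/

/-- Unordered key pairs: equal codes, equal pairs up to order. [folklore] -/
theorem kpair_eq {a b c d : ℕ × ℕ} (h : kpair a b = kpair c d) : (a = c ∧ b = d) ∨ (a = d ∧ b = c) := by
  unfold kpair at h
  split_ifs at h <;> simp only [Prod.mk.injEq] at h
  · exact Or.inl h
  · exact Or.inr h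
  · exact Or.inr ⟨h.2, h.1⟩
  · exact Or.inl ⟨h.2, h.1⟩

/-- The Boolean agreement of edge lists, unfolded (first half). [folklore] -/
theorem edgesAgree_left {A B : List ((ℕ × ℕ) × (ℕ × ℕ))} (h : edgesAgree A B = true) :
    ∀ e ∈ A, ∃ e' ∈ B, kpair e.1 e.2 = kpair e'.1 e'.2 := by
  unfold edgesAgree at h
  simp only [Bool.and_eq_true, List.all_eq_true, List.any_eq_true, beq_iff_eq] at h
  exact h.1

/-- The Boolean agreement of edge lists, unfolded (second half). [folklore] -/
theorem edgesAgree_right {A B : List ((ℕ × ℕ) × (ℕ × ℕ))} (h : edgesAgree A B = true) :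
    ∀ e ∈ B, ∃ e' ∈ A, kpair e.1 e.2 = kpair e'.1 e'.2 := by
  unfold edgesAgree at h
  simp only [Bool.and_eq_true, List.all_eq_true, List.any_eq_true, beq_iff_eq] at h
  exact h.2

/-- From the expected key pairs to the local edges of a tile. [folklore] -/
theorem adj_of_agree {T : Tile} {num : List (ℕ × ℕ)} {E : List ((ℕ × ℕ) × (ℕ × ℕ))} {nu : ℕ × ℕ → ℕ}
    (hagree : edgesAgree (edgeKeys T num) E = true) (hE : ∀ e ∈ E, (graph₂ φ).Adj (nu e.1) (nu e.2))
    {e : ℕ × ℕ × List GridPoint} (he : e ∈ T.edges) : (graph₂ φ).Adj (nu (num.getD e.1 (0, 0))) (nu (num.getD e.2.1 (0, 0))) := by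
  have hmem : kpair (num.getD e.1 (0, 0)) (num.getD e.2.1 (0, 0)) ∈ edgeKeys T num := by
    unfold edgeKeys; exact List.mem_map.2 ⟨e, he, rfl⟩
  obtain ⟨e', he', hk⟩ := edgesAgree_left hagree _ hmem
  have hk' : kpair (num.getD e.1 (0, 0)) (num.getD e.2.1 (0, 0)) = kpair e'.1 e'.2 := by
    have : ∀ x y : ℕ × ℕ, kpair (kpair x y).1 (kpair x y).2 = kpair x y := fun x y => by
      unfold kpair
      by_cases h1 : kcode x ≤ kcode y
      · rw [if_pos h1]; simp only; rw [if_pos h1]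
      · rw [if_neg h1]; simp only; rw [if_pos (by omega)]
    rw [← this, hk]
  rcases kpair_eq hk' with ⟨h1, h2⟩ | ⟨h1, h2⟩
  · rw [h1, h2]; exact hE e' he'
  · rw [h1, h2]; exact (hE e' he').symm

/-- **Every local edge of every placed tile joins the global numbers of its ends by an edge of the
gadget graph.** [folklore] -/
theorem localEdge_adj (hN : 0 < N φ) (hN3 : N φ = 3 * T φ + 1) {P : Placement} (hP : P ∈ placements φ)
    {e : ℕ × ℕ × List GridPoint} (he : e ∈ P.T.edges) : (graph₂ φ).Adj (P.ν e.1) (P.ν e.2.1) := by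
  obtain ⟨pd, hwf, rfl⟩ := exists_pd hP
  rw [PD.pl_ν, PD.pl_ν]
  cases pd with
  | dummy c =>
    exact adj_of_agree (dummy_edges (decide (c = 0)) (decide (c + 1 = N φ)) (prev? φ c).isNone) (dummyEdges_adj hN hwf) he
  | site r s =>
    exact adj_of_agree (site_edges (sF1 s) (sF2 φ s) (sF3 φ r s) (sF4 φ r s) (sF5 φ r s) (sMir r) (siteOK_flags hwf.1))
      (siteEdges_adj hN hN3 hwf.1 hwf.2) he
  | k0 => exact adj_of_agree (krow_edges (FormulaCells.polOf φ 0) false false false).1 (k0Edges_adj hN hN3) he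
  | clause t =>
    exact adj_of_agree (krow_edges false (cPols φ t).1 (cPols φ t).2.1 (cPols φ t).2.2).2.1 (clauseEdges_adj hN hN3 hwf) he
  | z => exact adj_of_agree (krow_edges false false false false).2.2 (zEdges_adj hN) he

/-! ### The tiling hypotheses: no parallel edges, degrees, and the assembled drawing -/

/-- The global names of a placement are injective on its local vertices. [folklore] -/
theorem ν_inj_placements (hN : 0 < N φ) (hN3 : N φ = 3 * T φ + 1) (hodd : N φ % 2 = 1) {P : Placement} (hP : P ∈ placements φ)
    {i j : ℕ} (hi : i < P.T.nv) (hj : j < P.T.nv) (h : P.ν i = P.ν j) : i = j := by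
  have h1 := (pos_eq_placements hN hN3 hodd P hP i hi).2
  have h2 := (pos_eq_placements hN hN3 hodd P hP j hj).2
  rw [h] at h1
  have := P.shift_injective (h1.symm.trans h2)
  exact (List.Nodup.getElem_inj_iff (valid_of_mem hP).2.1).1 this

/-- **No two drawn edges join the same two vertices.** [folklore] -/
theorem simple_placements (hN : 0 < N φ) (hN3 : N φ = 3 * T φ + 1) (hodd : N φ % 2 = 1) :
    (assemble (placements φ) (totalV φ) (gpos φ)).edges.Pairwise fun e e' => ¬ SDrawing.SameEndsS e e' := by
  unfold assemble
  rw [List.pairwise_flatMap]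
  constructor
  · intro P hP
    unfold Placement.gedges
    rw [List.pairwise_map]
    have hT := valid_of_mem hP
    refine hT.2.2.2.1.imp_of_mem fun {e e'} he he' hne => ?_
    unfold SDrawing.SameEndsS
    simp only
    rintro (⟨h1, h2⟩ | ⟨h1, h2⟩)
    · exact hne (Or.inl ⟨ν_inj_placements hN hN3 hodd hP (hT.edge he).1 (hT.edge he').1 h1,
        ν_inj_placements hN hN3 hodd hP (hT.edge he).2.1 (hT.edge he').2.1 h2⟩)
    · exact hne (Or.inr ⟨ν_inj_placements hN hN3 hodd hP (hT.edge he).1 (hT.edge he').2.1 h1,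
        ν_inj_placements hN hN3 hodd hP (hT.edge he).2.1 (hT.edge he').1 h2⟩)
  · refine List.Pairwise.imp_of_mem ?_ (nodup_placements hN)
    intro P Q hP hQ hPQ d hd d' hd' hsame
    obtain ⟨e, he, rfl⟩ := P.mem_gedges_iff.1 hd
    obtain ⟨e', he', rfl⟩ := Q.mem_gedges_iff.1 hd'
    have hT := valid_of_mem hP
    have hv := hT.edge he
    have hv' := (valid_of_mem hQ).edge he'
    -- both ends of `e` are shared with `Q`, hence on the boundary of `P`: excluded
    apply hv.2.2.2.2.2.2.2.2
    have key : ∀ {i j : ℕ} (hi : i < P.T.nv) (hj : j < Q.T.nv), P.ν i = Q.ν j → ∀ p ∈ P.T.pos[i]?, P.T.OnBdry p := by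
      intro i j hi hj hij p hp
      rw [List.getElem?_eq_getElem hi, Option.mem_def, Option.some.injEq] at hp
      subst hp
      have h1 := (pos_eq_placements hN hN3 hodd P hP i hi).2
      have h2 := (pos_eq_placements hN hN3 hodd Q hQ j hj).2
      rw [hij] at h1
      have heq := h1.symm.trans h2
      have hq1 : P.Box (P.shift P.T.pos[i]) := P.box_shift.2 (hT.1 _ (List.getElem_mem hi)).1
      have hq2 : Q.Box (P.shift P.T.pos[i]) := by
        rw [heq]; exact Q.box_shift.2 ((valid_of_mem hQ).1 _ (List.getElem_mem hj)).1
      exact P.bdry_shift.1 (boxes_placements hN hP hQ hPQ _ hq1 hq2).1.1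
    unfold SDrawing.SameEndsS at hsame
    simp only at hsame
    rcases hsame with ⟨h1, h2⟩ | ⟨h1, h2⟩
    · exact ⟨key hv.1 hv'.1 h1, key hv.2.1 hv'.2.1 h2⟩
    · exact ⟨key hv.1 hv'.2.1 h1, key hv.2.1 hv'.1 h2⟩

/-- **Every vertex of the assembled drawing has degree at most three** (its incident drawn edges
join it to distinct neighbours in `graph₂`, which has degree at most three). [folklore] -/
theorem degree_placements (hN : 0 < N φ) (hN3 : N φ = 3 * T φ + 1) (hodd : N φ % 2 = 1) (v : ℕ) :
    (assemble (placements φ) (totalV φ) (gpos φ)).degree v ≤ 3 := by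
  classical
  set E := (assemble (placements φ) (totalV φ) (gpos φ)).edges with hE
  obtain ⟨s, hs, hnb⟩ := graph₂_nbrsLe (φ := φ) v
  unfold SDrawing.degree
  rw [List.countP_eq_length_filter]
  set F := E.filter (fun e => decide (e.1 = v ∨ e.2.1 = v)) with hF
  -- the other end of an incident edge
  let oth : SEdge ℕ → ℕ := fun e => if e.1 = v then e.2.1 else e.1
  have hadj : ∀ e ∈ F, (graph₂ φ).Adj v (oth e) := by
    intro e he
    rw [hF, List.mem_filter, decide_eq_true_eq] at he
    obtain ⟨P, hP, e', he', rfl⟩ := mem_assemble_edges.1 he.1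
    have ha := localEdge_adj hN hN3 hP he'
    dsimp only [oth]
    split_ifs with h1
    · rw [← h1]; exact ha
    · rcases he.2 with h | h
      · exact absurd h h1
      · rw [← h]; exact ha.symm
  have hpw : F.Pairwise fun e e' => ¬ SDrawing.SameEndsS e e' := (simple_placements hN hN3 hodd).sublist List.filter_sublist
  have hFnd : F.Nodup := hpw.imp fun {a b} h hab => h (by rw [hab]; exact Or.inl ⟨rfl, rfl⟩)
  haveI hsymm : Std.Symm fun e e' : SEdge ℕ => ¬ SDrawing.SameEndsS e e' := ⟨by
    intro a b h hs; apply h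
    unfold SDrawing.SameEndsS at hs ⊢
    rcases hs with ⟨h1, h2⟩ | ⟨h1, h2⟩
    · exact Or.inl ⟨h1.symm, h2.symm⟩
    · exact Or.inr ⟨h2.symm, h1.symm⟩⟩
  have hnd : (F.map oth).Nodup := by
    refine List.Nodup.map_on (fun x hx y hy hxy => ?_) hFnd
    by_contra hne
    have hns := hpw.forall hx hy hne
    rw [hF, List.mem_filter, decide_eq_true_eq] at hx hy
    apply hns
    unfold SDrawing.SameEndsS
    simp only [oth] at hxy
    split_ifs at hxy with h1 h2 h2
    · exact Or.inl ⟨h1.trans h2.symm, hxy⟩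
    · rcases hy.2 with h | h
      · exact absurd h h2
      · exact Or.inr ⟨h1.trans h.symm, hxy⟩
    · rcases hx.2 with h | h
      · exact absurd h h1
      · exact Or.inr ⟨hxy, h.trans h2.symm⟩
    · rcases hx.2 with h | h
      · exact absurd h h1
      · rcases hy.2 with h' | h'
        · exact absurd h' h2
        · exact Or.inl ⟨hxy, h.trans h'.symm⟩
  have hsub : (F.map oth).toFinset ⊆ s := by
    intro w hw
    rw [List.mem_toFinset, List.mem_map] at hw
    obtain ⟨e, he, rfl⟩ := hw
    exact hnb _ (hadj e he)
  calc F.length = (F.map oth).length := (List.length_map _).symm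
    _ = (F.map oth).toFinset.card := (List.toFinset_card_of_nodup hnd).symm
    _ ≤ s.card := Finset.card_le_card hsub
    _ ≤ 3 := hs

/-- **The tiling hypotheses hold for the placements of the gadget graph.** [folklore] -/
theorem tilingHyps (hN : 0 < N φ) (hN3 : N φ = 3 * T φ + 1) (hodd : N φ % 2 = 1) :
    TilingHyps (placements φ) (totalV φ) (gpos φ) where
  nodup := nodup_placements hN
  valid := fun _ hP => valid_of_mem hP
  pos_eq := pos_eq_placements hN hN3 hodd
  boxes := fun _ hP _ hQ hPQ q h1 h2 => boxes_placements hN hP hQ hPQ q h1 h2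
  crosslist := crosslist_placements hN hN3 hodd
  shared := shared_placements hN hN3 hodd
  cover := cover_placements hN hN3 hodd
  degree := fun v _ => degree_placements hN hN3 hodd v

/-- **The assembled drawing of the gadget graph is a valid structured grid drawing.** [folklore] -/
theorem drawing_isValid (hN : 0 < N φ) (hN3 : N φ = 3 * T φ + 1) (hodd : N φ % 2 = 1) :
    (assemble (placements φ) (totalV φ) (gpos φ)).IsValid :=
  assemble_isValid (tilingHyps hN hN3 hodd)

end LOTDrawing

/-! ## Every edge is drawn (formerly `GridSAWLOTDrawingEdges.lean`)

# The grid drawing of the `#3SAT → #HamPath` gadget graph, III: every edge is drawn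

The converse half of the dictionary of `GridSAWLOTDrawingDict.lean`: every edge of the gadget graph
`graph₂ φ` (`HamiltonianLOTCount.lean`) joins the global numbers of the two ends of a local edge of
some placed tile (`LOTDrawing.placements`, `GridSAWLOTDrawing.lean`). The proof classifies the edges
of `graph₂ φ` — surviving chain edges, diamond-ladder / pin / clause-gadget edges of the first
substitution stage that are not hop slots, and the XOR-ladders of the second stage — and locates for
each the tile and the pair of keys drawing it; that the tile draws that key pair is one of the
`decide`d agreement facts of `GridSAWLOTTilesIndex.lean` (`site_edges`, `dummy_edges`,
`krow_edges`, read through `edgesAgree_right`).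

* `LOTDrawing.Drawn φ a b` — some local edge of some placed tile joins `a` and `b`;
* `drawn_of_keys` and its specialisations `dS`, `dD`, `dK`, `dC`, `dZ` (one per kind of tile);
* `drawn_xor`, `drawn_or1`, `drawn_or3` — a placed rail gadget is drawn once its rails, rungs and
  port edges are; `drawn_hop`, `drawn_set`, `drawn_klink`, `drawn_dl`, `drawn_pin`, `drawn_cl1`,
  `drawn_or3'` — the gadgets of `graph₂ φ`; `drawn_chain` — the surviving chain edges;
* **`drawn_of_adj`** — every edge of `graph₂ φ` is drawn; with `localEdge_adj` (part II) this is the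
  dictionary `adj_iff_drawn` between `graph₂ φ` and the assembled drawing.

## References

* M. Liśkiewicz, M. Ogihara, S. Toda, TCS 304 (2003) 129–156, §4 (proof of Theorem 7, `E₀`: the
  drawing realises exactly the edges of the gadget graph).
-/

namespace LOTDrawing

open Literature.Computability.Complexity Literature.Combinatorics.SimpleGraph
open Literature.Combinatorics.SimpleGraph.LOTReduction LOTTiles

variable {φ : CNF ℕ}

/-! ### Drawn pairs of global vertices -/

variable (φ) in
/-- **The pair `{a, b}` is drawn**: a local edge of a placed tile joins the global vertices `a` and
`b`. [folklore] -/
def Drawn (a b : ℕ) : Prop :=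
  ∃ P ∈ placements φ, ∃ e ∈ P.T.edges, (P.ν e.1 = a ∧ P.ν e.2.1 = b) ∨ (P.ν e.1 = b ∧ P.ν e.2.1 = a)

/-- Drawn pairs are unordered. [folklore] -/
theorem Drawn.symm {a b : ℕ} (h : Drawn φ a b) : Drawn φ b a := by
  obtain ⟨P, hP, e, he, h⟩ := h
  exact ⟨P, hP, e, he, h.symm⟩

/-- Transport of a drawn pair along equalities of its ends. [folklore] -/
theorem Drawn.of_eq {a b a' b' : ℕ} (h : Drawn φ a' b') (ha : a' = a) (hb : b' = b) : Drawn φ a b := ha ▸ hb ▸ h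

/-- `kpair` is idempotent. [folklore] -/
theorem kpair_kpair (x y : ℕ × ℕ) : kpair (kpair x y).1 (kpair x y).2 = kpair x y := by
  unfold kpair
  by_cases h1 : kcode x ≤ kcode y
  · rw [if_pos h1]; simp only; rw [if_pos h1]
  · rw [if_neg h1]; simp only; rw [if_pos (by omega)]

/-- **From an expected key pair to a drawn pair**: if the local edges of a descriptor's tile agree
with the expected key pairs `E`, every pair of `E` is drawn between the global numbers of its keys. [folklore] -/
theorem drawn_of_keys {pd : PD} (hwf : pd.WF φ) {E : List ((ℕ × ℕ) × (ℕ × ℕ))}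
    (hagree : edgesAgree (edgeKeys (pd.pl φ).T (pd.num φ)) E = true) {k₁ k₂ : ℕ × ℕ} (hk : (k₁, k₂) ∈ E) :
    Drawn φ (pd.ν φ k₁) (pd.ν φ k₂) := by
  obtain ⟨e', he', hk'⟩ := edgesAgree_right hagree _ hk
  unfold edgeKeys at he'
  obtain ⟨e₀, he₀, rfl⟩ := List.mem_map.1 he'
  rw [kpair_kpair] at hk'
  refine ⟨pd.pl φ, PD.pl_mem hwf, e₀, he₀, ?_⟩
  rw [PD.pl_ν, PD.pl_ν]
  rcases kpair_eq hk' with ⟨h1, h2⟩ | ⟨h1, h2⟩ <;> simp only at h1 h2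
  · exact Or.inl ⟨by rw [h1], by rw [h2]⟩
  · exact Or.inr ⟨by rw [h2], by rw [h1]⟩

/-- Site tiles: an expected key pair is drawn between the numbers of its keys. [folklore] -/
theorem dS {r s : ℕ} (hr : r < N φ) (hs : s < N φ) {A₁ d₁ A₂ d₂ : ℕ}
    (hk : ((A₁, d₁), (A₂, d₂)) ∈ siteEdges (sF1 s) (sF2 φ s) (sF3 φ r s) (sF4 φ r s) (sF5 φ r s)) {a b : ℕ}
    (ha : siteAnchor φ r s A₁ + d₁ = a) (hb : siteAnchor φ r s A₂ + d₂ = b) : Drawn φ a b :=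
  (drawn_of_keys (pd := .site r s) ⟨hr, hs⟩ (site_edges _ _ _ _ _ (sMir r) (siteOK_flags hr)) hk).of_eq ha hb

/-- Dummy-pair tiles: an expected key pair is drawn. [folklore] -/
theorem dD {c : ℕ} (hc : c < N φ) {A₁ d₁ A₂ d₂ : ℕ}
    (hk : ((A₁, d₁), (A₂, d₂)) ∈ dummyEdges (decide (c + 1 = N φ)) (prev? φ c).isNone) {a b : ℕ}
    (ha : dummyAnchor φ c A₁ + d₁ = a) (hb : dummyAnchor φ c A₂ + d₂ = b) : Drawn φ a b :=
  (drawn_of_keys (pd := .dummy c) hc (dummy_edges (decide (c = 0)) _ _) hk).of_eq ha hb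

/-- The tile of `K_0`: an expected key pair is drawn. [folklore] -/
theorem dK {A₁ d₁ A₂ d₂ : ℕ} (hk : ((A₁, d₁), (A₂, d₂)) ∈ k0Edges (FormulaCells.polOf φ 0)) {a b : ℕ}
    (ha : k0Anchor φ A₁ + d₁ = a) (hb : k0Anchor φ A₂ + d₂ = b) : Drawn φ a b :=
  (drawn_of_keys (pd := .k0) trivial (krow_edges (FormulaCells.polOf φ 0) false false false).1 hk).of_eq ha hb

/-- Clause tiles: an expected key pair is drawn. [folklore] -/
theorem dC {t : ℕ} (ht : t < T φ) {A₁ d₁ A₂ d₂ : ℕ}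
    (hk : ((A₁, d₁), (A₂, d₂)) ∈ clauseEdges (cPols φ t).1 (cPols φ t).2.1 (cPols φ t).2.2) {a b : ℕ}
    (ha : clauseAnchor φ t A₁ + d₁ = a) (hb : clauseAnchor φ t A₂ + d₂ = b) : Drawn φ a b :=
  (drawn_of_keys (pd := .clause t) ht (krow_edges false _ _ _).2.1 hk).of_eq ha hb

/-- The end tile: an expected key pair is drawn. [folklore] -/
theorem dZ {A₁ d₁ A₂ d₂ : ℕ} (hk : ((A₁, d₁), (A₂, d₂)) ∈ zEdges) {a b : ℕ}
    (ha : 5 * zIdx φ + d₁ = a) (hb : 5 * zIdx φ + d₂ = b) : Drawn φ a b :=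
  (drawn_of_keys (pd := .z) trivial (krow_edges false false false false).2.2 hk).of_eq ha hb

/-! ### The expected key pairs, with natural-number indices -/

section facts

variable (f l t s0 s1 : Bool)

/-- Hop ladders `h₁ … h₄` of a site. [folklore] -/
theorem F_hop {H : ℕ} (hH : H < 4) :
    (∀ ρ < 2, ∀ u < 3, ((4, 12 * H + 12 + 4 * ρ + u), (4, 12 * H + 12 + 4 * ρ + u + 1)) ∈ siteEdges f l t s0 s1) ∧
    (∀ ρ < 2, ∀ u < 4, ((4, 12 * H + 12 + 4 * ρ + u), (4, 12 * H + 20 + u)) ∈ siteEdges f l t s0 s1) ∧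
    ((2, 8 + 4 * H), (4, 12 * H + 12)) ∈ siteEdges f l t s0 s1 ∧ ((2, 10 + 4 * H), (4, 12 * H + 15)) ∈ siteEdges f l t s0 s1 ∧
    (H < 3 → ((2, 12 + 4 * H), (4, 12 * H + 16)) ∈ siteEdges f l t s0 s1 ∧
      ((2, 13 + 4 * H), (4, 12 * H + 19)) ∈ siteEdges f l t s0 s1) := by
  obtain ⟨h1, h2, h3, h4, h5⟩ := mem_siteEdges_hop f l t s0 s1 ⟨H, hH⟩
  exact ⟨fun ρ hρ u hu => h1 ⟨ρ, hρ⟩ ⟨u, hu⟩, fun ρ hρ u hu => h2 ⟨ρ, hρ⟩ ⟨u, hu⟩, h3, h4, h5⟩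

/-- `h₀`'s second rail and ports at `p₀ a₀`, `h₄`'s door ports, the exit ladder's first rail. [folklore] -/
theorem F_h0 :
    (∀ u < 3, ((4, 4 + u), (4, 4 + u + 1)) ∈ siteEdges f l t s0 s1) ∧ (∀ u < 4, ((4, 4 + u), (4, 8 + u)) ∈ siteEdges f l t s0 s1) ∧
    ((2, 8), (4, 4)) ∈ siteEdges f l t s0 s1 ∧ ((2, 9), (4, 7)) ∈ siteEdges f l t s0 s1 ∧
    ((0, 6), (4, 52)) ∈ siteEdges f l t s0 s1 ∧ ((0, 7), (4, 55)) ∈ siteEdges f l t s0 s1 ∧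
    (∀ u < 3, ((5, u), (5, u + 1)) ∈ siteEdges f l t s0 s1) ∧ (∀ u < 4, ((5, u), (5, 8 + u)) ∈ siteEdges f l t s0 s1) ∧
    (t = true → ((0, 4), (5, 0)) ∈ siteEdges f l t s0 s1 ∧ ((0, 3), (5, 3)) ∈ siteEdges f l t s0 s1) ∧
    (t = false → ((0, 8), (5, 0)) ∈ siteEdges f l t s0 s1 ∧ ((0, 6), (5, 3)) ∈ siteEdges f l t s0 s1) := by
  obtain ⟨h1, h2, h3, h4, h5, h6, h7, h8, h9, h10⟩ := mem_siteEdges_h0_exit f l t s0 s1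
  exact ⟨fun u hu => h1 ⟨u, hu⟩, fun u hu => h2 ⟨u, hu⟩, h3, h4, h5, h6, fun u hu => h7 ⟨u, hu⟩, fun u hu => h8 ⟨u, hu⟩, h9, h10⟩

/-- The set ladder of a site. [folklore] -/
theorem F_set :
    (s0 = true → (∀ u < 3, ((6, u), (6, u + 1)) ∈ siteEdges f l t s0 s1) ∧ (∀ u < 4, ((6, u), (6, 8 + u)) ∈ siteEdges f l t s0 s1) ∧
      ((0, 6), (6, 0)) ∈ siteEdges f l t s0 s1 ∧ ((0, 8), (6, 3)) ∈ siteEdges f l t s0 s1) ∧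
    ((s1 || (s0 && l)) = true → (∀ u < 3, ((6, 4 + u), (6, 4 + u + 1)) ∈ siteEdges f l t s0 s1) ∧
      (∀ u < 4, ((6, 4 + u), (6, 8 + u)) ∈ siteEdges f l t s0 s1)) ∧
    (s1 = true → ((0, 3), (6, 4)) ∈ siteEdges f l t s0 s1 ∧ ((0, 1), (6, 7)) ∈ siteEdges f l t s0 s1) ∧
    ((s0 && l) = true → ((0, 13), (6, 4)) ∈ siteEdges f l t s0 s1 ∧ ((0, 11), (6, 7)) ∈ siteEdges f l t s0 s1) := by
  obtain ⟨h1, h2, h3, h4⟩ := mem_siteEdges_set f l t s0 s1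
  refine ⟨fun h => ?_, fun h => ?_, h3, h4⟩
  · obtain ⟨a, b, c, d⟩ := h1 h; exact ⟨fun u hu => a ⟨u, hu⟩, fun u hu => b ⟨u, hu⟩, c, d⟩
  · obtain ⟨a, b⟩ := h2 h; exact ⟨fun u hu => a ⟨u, hu⟩, fun u hu => b ⟨u, hu⟩⟩

/-- The diamond ladder of a site, the previous ladder's second rail, the last site. [folklore] -/
theorem F_dl :
    (∀ u < 3, ((2, u), (2, u + 1)) ∈ siteEdges f l t s0 s1) ∧
    (∀ k < 4, ((2, k), (2, 8 + 4 * k)) ∈ siteEdges f l t s0 s1 ∧ ((2, 9 + 4 * k), (2, 10 + 4 * k)) ∈ siteEdges f l t s0 s1 ∧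
      ((2, 9 + 4 * k), (2, 11 + 4 * k)) ∈ siteEdges f l t s0 s1 ∧ ((2, 10 + 4 * k), (2, 11 + 4 * k)) ∈ siteEdges f l t s0 s1) ∧
    ((0, 2), (2, 0)) ∈ siteEdges f l t s0 s1 ∧ ((0, 4), (2, 3)) ∈ siteEdges f l t s0 s1 ∧
    (f = false → (∀ u < 3, ((3, 4 + u), (3, 4 + u + 1)) ∈ siteEdges f l t s0 s1) ∧
      (∀ k < 4, ((3, 4 + k), (3, 11 + 4 * k)) ∈ siteEdges f l t s0 s1) ∧
      ((0, 1), (3, 7)) ∈ siteEdges f l t s0 s1 ∧ ((0, 2), (3, 4)) ∈ siteEdges f l t s0 s1) ∧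
    (l = true → (∀ u < 3, ((2, 4 + u), (2, 4 + u + 1)) ∈ siteEdges f l t s0 s1) ∧
      (∀ k < 4, ((2, 4 + k), (2, 11 + 4 * k)) ∈ siteEdges f l t s0 s1) ∧
      ((0, 11), (2, 7)) ∈ siteEdges f l t s0 s1 ∧ ((0, 12), (2, 4)) ∈ siteEdges f l t s0 s1 ∧
      ((0, 10), (0, 11)) ∈ siteEdges f l t s0 s1 ∧ ((0, 12), (0, 13)) ∈ siteEdges f l t s0 s1 ∧
      ((0, 12), (0, 14)) ∈ siteEdges f l t s0 s1 ∧ ((0, 13), (0, 14)) ∈ siteEdges f l t s0 s1 ∧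
      ((0, 14), (1, 0)) ∈ siteEdges f l t s0 s1 ∧ (s0 = false → ((0, 11), (0, 13)) ∈ siteEdges f l t s0 s1)) := by
  obtain ⟨h1, h2, h3, h4, h5, h6⟩ := mem_siteEdges_dl f l t s0 s1
  refine ⟨fun u hu => h1 ⟨u, hu⟩, fun k hk => h2 ⟨k, hk⟩, h3, h4, fun h => ?_, fun h => ?_⟩
  · obtain ⟨a, b, c, d⟩ := h5 h; exact ⟨fun u hu => a ⟨u, hu⟩, fun k hk => b ⟨k, hk⟩, c, d⟩
  · obtain ⟨a, b, c⟩ := h6 h; exact ⟨fun u hu => a ⟨u, hu⟩, fun k hk => b ⟨k, hk⟩, c⟩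

end facts

/-- The dummy-pair tile's key pairs with natural-number indices. [folklore] -/
theorem F_dummy (l v : Bool) :
    (∀ u < 3, ((3, u), (3, u + 1)) ∈ dummyEdges l v) ∧ (∀ u < 4, ((3, u), (3, 8 + u)) ∈ dummyEdges l v) ∧
    (v = true → (∀ ρ < 2, ∀ u < 3, ((4, 4 * ρ + u), (4, 4 * ρ + u + 1)) ∈ dummyEdges l v) ∧
      (∀ ρ < 2, ∀ u < 4, ((4, 4 * ρ + u), (4, 8 + u)) ∈ dummyEdges l v) ∧
      ((0, 3), (4, 0)) ∈ dummyEdges l v ∧ ((0, 4), (4, 3)) ∈ dummyEdges l v ∧ ((0, 8), (4, 4)) ∈ dummyEdges l v ∧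
      ((0, 6), (4, 7)) ∈ dummyEdges l v) := by
  obtain ⟨-, -, -, -, -, -, -, -, -, -, -, -, -, -, -, -, -, -, -, -, -, h1, h2, -, -, h3⟩ := mem_dummyEdges l v
  refine ⟨fun u hu => h1 ⟨u, hu⟩, fun u hu => h2 ⟨u, hu⟩, fun h => ?_⟩
  obtain ⟨a, b, c⟩ := h3 h
  exact ⟨fun ρ hρ u hu => a ⟨ρ, hρ⟩ ⟨u, hu⟩, fun ρ hρ u hu => b ⟨ρ, hρ⟩ ⟨u, hu⟩, c⟩

/-- The `K_0` tile's link rails with natural-number indices. [folklore] -/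
theorem F_k0 (p : Bool) :
    (∀ u < 3, ((1, 4 + u), (1, 4 + u + 1)) ∈ k0Edges p) ∧ (∀ u < 4, ((1, 4 + u), (1, 8 + u)) ∈ k0Edges p) := by
  obtain ⟨-, -, -, -, -, -, h1, h2, -⟩ := mem_k0Edges p
  exact ⟨fun u hu => h1 ⟨u, hu⟩, fun u hu => h2 ⟨u, hu⟩⟩

/-- The clause tiles' cells, links and OR-rails with natural-number indices. [folklore] -/
theorem F_clause (p0 p1 p2 : Bool) {V : ℕ} (hV : V < 3) :
    ((0, 5 * V), (0, 5 * V + 1)) ∈ clauseEdges p0 p1 p2 ∧ ((0, 5 * V + 2), (0, 5 * V + 3)) ∈ clauseEdges p0 p1 p2 ∧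
    ((0, 5 * V + 2), (0, 5 * V + 4)) ∈ clauseEdges p0 p1 p2 ∧ ((0, 5 * V + 4), (0, 5 * V + 5)) ∈ clauseEdges p0 p1 p2 ∧
    ((if V = 0 then p0 else if V = 1 then p1 else p2) = true → ((0, 5 * V + 3), (0, 5 * V + 4)) ∈ clauseEdges p0 p1 p2 ∧
      ((0, 5 * V + 1), (2, 6 * V)) ∈ clauseEdges p0 p1 p2 ∧ ((0, 5 * V + 3), (2, 6 * V + 5)) ∈ clauseEdges p0 p1 p2) ∧
    ((if V = 0 then p0 else if V = 1 then p1 else p2) = false → ((0, 5 * V + 1), (0, 5 * V + 3)) ∈ clauseEdges p0 p1 p2 ∧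
      ((0, 5 * V + 3), (2, 6 * V)) ∈ clauseEdges p0 p1 p2 ∧ ((0, 5 * V + 4), (2, 6 * V + 5)) ∈ clauseEdges p0 p1 p2) ∧
    (∀ u < 3, ((1, 12 * V + 4 + u), (1, 12 * V + 4 + u + 1)) ∈ clauseEdges p0 p1 p2) ∧
    (∀ u < 4, ((1, 12 * V + 4 + u), (1, 12 * V + 8 + u)) ∈ clauseEdges p0 p1 p2) ∧
    ((0, 5 * V + 1), (1, 12 * V + 4)) ∈ clauseEdges p0 p1 p2 ∧ ((0, 5 * V + 2), (1, 12 * V + 7)) ∈ clauseEdges p0 p1 p2 ∧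
    (∀ u < 5, ((2, 6 * V + u), (2, 6 * V + u + 1)) ∈ clauseEdges p0 p1 p2) := by
  obtain ⟨h1, h2, h3, h4, h5, h6, h7, h8, h9, h10, h11⟩ := mem_clauseEdges_cell p0 p1 p2 ⟨V, hV⟩
  exact ⟨h1, h2, h3, h4, h5, h6, fun u hu => h7 ⟨u, hu⟩, fun u hu => h8 ⟨u, hu⟩, h9, h10, fun u hu => h11 ⟨u, hu⟩⟩

/-! ### Placed rail gadgets are drawn from their rails, rungs and ports -/

/-- A rail index of a two-rail gadget. [folklore] -/
theorem fin2_cases (r : Fin 2) : r = 0 ∨ r = 1 := by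
  rcases r with ⟨_ | _ | n, h⟩
  · exact Or.inl rfl
  · exact Or.inr rfl
  · exact absurd h (by omega)

/-- A rail index of a three-rail gadget. [folklore] -/
theorem fin3_cases (r : Fin 3) : r = 0 ∨ r = 1 ∨ r = 2 := by
  rcases r with ⟨_ | _ | _ | n, h⟩
  · exact Or.inl rfl
  · exact Or.inr (Or.inl rfl)
  · exact Or.inr (Or.inr rfl)
  · exact absurd h (by omega)

/-- **The edges of a placed XOR-gadget are drawn** once its rails, rungs and four port edges are
(`node (ρ, t) ↦ B + 4ρ + t`, `mid t ↦ B + 8 + t`, ports `↦` the slot ends `p`). [folklore] -/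
theorem drawn_xor {B : ℕ} {p : (ℕ × ℕ) × (ℕ × ℕ)}
    (hrail : ∀ ρ < 2, ∀ t < 3, Drawn φ (B + (ρ * 4 + t)) (B + (ρ * 4 + (t + 1))))
    (hrung : ∀ ρ < 2, ∀ t < 4, Drawn φ (B + (ρ * 4 + t)) (B + (8 + t)))
    (hp11 : Drawn φ p.1.1 B) (hp12 : Drawn φ p.1.2 (B + 3))
    (hp21 : Drawn φ p.2.1 (B + 4)) (hp22 : Drawn φ p.2.2 (B + 7))
    {x y : RailV 2 4 4} (hxy : RailXOR.Γ.graph.Adj x y) :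
    Drawn φ (railNum (K := 4) B (ends₂ p) x) (railNum (K := 4) B (ends₂ p) y) := by
  obtain ⟨u, v, hor, hc⟩ := RailGadget.adj_cases _ hxy
  suffices H : Drawn φ (railNum (K := 4) B (ends₂ p) u) (railNum (K := 4) B (ends₂ p) v) by
    rcases hor with ⟨rfl, rfl⟩ | ⟨rfl, rfl⟩
    exacts [H, H.symm]
  have e0 : ends₂ p 0 = p.1 := rfl
  have e1 : ends₂ p 1 = p.2 := by unfold ends₂; rw [if_neg (by decide)]
  rcases hc with ⟨r, t, t', rfl, rfl, ht⟩ | ⟨ρ, rfl, hv⟩ | ⟨r, t, rfl, rfl, ht⟩ | ⟨r, t, rfl, rfl, ht⟩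
  · refine (hrail r.val r.isLt t.val (by have := t'.isLt; omega)).of_eq rfl ?_
    show B + (r.val * 4 + (t.val + 1)) = B + (r.val * 4 + t'.val); omega
  · rcases hv with rfl | rfl
    · refine (hrung 0 (by omega) ρ.val ρ.isLt).symm.of_eq ?_ ?_
      · show B + (8 + ρ.val) = B + (2 * 4 + ρ.val); omega
      · show B + (0 * 4 + ρ.val) = B + ((0 : Fin 2).val * 4 + ρ.val); rfl
    · refine (hrung 1 (by omega) ρ.val ρ.isLt).symm.of_eq ?_ ?_
      · show B + (8 + ρ.val) = B + (2 * 4 + ρ.val); omega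
      · show B + (1 * 4 + ρ.val) = B + ((1 : Fin 2).val * 4 + ρ.val); rfl
  · rcases fin2_cases r with rfl | rfl
    · refine hp11.of_eq ?_ ?_
      · show p.1.1 = (ends₂ p 0).1; rw [e0]
      · show B = B + ((0 : Fin 2).val * 4 + t.val); simp only [Fin.val_zero]; omega
    · refine hp21.of_eq ?_ ?_
      · show p.2.1 = (ends₂ p 1).1; rw [e1]
      · show B + 4 = B + ((1 : Fin 2).val * 4 + t.val); simp only [Fin.val_one]; omega
  · rcases fin2_cases r with rfl | rfl
    · refine hp12.of_eq ?_ ?_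
      · show p.1.2 = (ends₂ p 0).2; rw [e0]
      · show B + 3 = B + ((0 : Fin 2).val * 4 + t.val); simp only [Fin.val_zero]; omega
    · refine hp22.of_eq ?_ ?_
      · show p.2.2 = (ends₂ p 1).2; rw [e1]
      · show B + 7 = B + ((1 : Fin 2).val * 4 + t.val); simp only [Fin.val_one]; omega

/-- **The edges of a placed one-rail gadget** (pins, unit clause: nodes `B, B + 1`, rung `B + 2`,
ports the slot `e`) are drawn once its three inner edges and two port edges are. [folklore] -/
theorem drawn_or1 {B : ℕ} {e : ℕ × ℕ}
    (h01 : Drawn φ B (B + 1)) (h0m : Drawn φ B (B + 2)) (h1m : Drawn φ (B + 1) (B + 2))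
    (hpt : Drawn φ e.1 B) (hpf : Drawn φ e.2 (B + 1))
    {x y : RailV 1 2 1} (hxy : RailOR1.Γ.graph.Adj x y) :
    Drawn φ (railNum (K := 2) B (fun _ => e) x) (railNum (K := 2) B (fun _ => e) y) := by
  obtain ⟨u, v, hor, hc⟩ := RailGadget.adj_cases _ hxy
  suffices H : Drawn φ (railNum (K := 2) B (fun _ => e) u) (railNum (K := 2) B (fun _ => e) v) by
    rcases hor with ⟨rfl, rfl⟩ | ⟨rfl, rfl⟩
    exacts [H, H.symm]
  rcases hc with ⟨r, t, t', rfl, rfl, ht⟩ | ⟨ρ, rfl, hv⟩ | ⟨r, t, rfl, rfl, ht⟩ | ⟨r, t, rfl, rfl, ht⟩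
  · refine h01.of_eq ?_ ?_
    · show B = B + (r.val * 2 + t.val); have := r.isLt; have := t'.isLt; omega
    · show B + 1 = B + (r.val * 2 + t'.val); have := r.isLt; have := t'.isLt; omega
  · rcases hv with rfl | rfl
    · refine h0m.symm.of_eq ?_ ?_
      · show B + 2 = B + (1 * 2 + ρ.val); have := ρ.isLt; omega
      · show B = B + ((RailOR1.Γ.fst ρ).1.val * 2 + (RailOR1.Γ.fst ρ).2.val)
        rw [show RailOR1.Γ.fst ρ = (0, 0) from rfl]; rfl
    · refine h1m.symm.of_eq ?_ ?_
      · show B + 2 = B + (1 * 2 + ρ.val); have := ρ.isLt; omega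
      · show B + 1 = B + ((RailOR1.Γ.snd ρ).1.val * 2 + (RailOR1.Γ.snd ρ).2.val)
        rw [show RailOR1.Γ.snd ρ = (0, 1) from rfl]; rfl
  · refine hpt.of_eq rfl ?_
    show B = B + (r.val * 2 + t.val); have := r.isLt; omega
  · refine hpf.of_eq rfl ?_
    show B + 1 = B + (r.val * 2 + t.val); have := r.isLt; omega

/-- **The edges of a placed three-input OR-gadget** (`node (ρ, u) ↦ B + 6ρ + u`, `mid ρ ↦ B + 18 + ρ`,
ports `↦` the literal slots `e ρ`) are drawn once its rails, rungs and ports are. [folklore] -/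
theorem drawn_or3 {B : ℕ} {e : Fin 3 → ℕ × ℕ}
    (hrail : ∀ ρ < 3, ∀ u < 5, Drawn φ (B + (ρ * 6 + u)) (B + (ρ * 6 + (u + 1))))
    (hrung : ∀ ρ : Fin 9, Drawn φ (B + ((RailOR3.fst ρ).1.val * 6 + (RailOR3.fst ρ).2.val)) (B + (18 + ρ.val)) ∧
      Drawn φ (B + ((RailOR3.snd ρ).1.val * 6 + (RailOR3.snd ρ).2.val)) (B + (18 + ρ.val)))
    (hpt : ∀ ρ : Fin 3, Drawn φ (e ρ).1 (B + (ρ.val * 6 + 0))) (hpf : ∀ ρ : Fin 3, Drawn φ (e ρ).2 (B + (ρ.val * 6 + 5)))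
    {x y : RailV 3 6 9} (hxy : RailOR3.Γ.graph.Adj x y) :
    Drawn φ (railNum (K := 6) B e x) (railNum (K := 6) B e y) := by
  obtain ⟨u, v, hor, hc⟩ := RailGadget.adj_cases _ hxy
  suffices H : Drawn φ (railNum (K := 6) B e u) (railNum (K := 6) B e v) by
    rcases hor with ⟨rfl, rfl⟩ | ⟨rfl, rfl⟩
    exacts [H, H.symm]
  rcases hc with ⟨r, t, t', rfl, rfl, ht⟩ | ⟨ρ, rfl, hv⟩ | ⟨r, t, rfl, rfl, ht⟩ | ⟨r, t, rfl, rfl, ht⟩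
  · refine (hrail r.val r.isLt t.val (by have := t'.isLt; omega)).of_eq rfl ?_
    show B + (r.val * 6 + (t.val + 1)) = B + (r.val * 6 + t'.val); omega
  · rcases hv with rfl | rfl
    · exact ((hrung ρ).1.symm).of_eq rfl rfl
    · exact ((hrung ρ).2.symm).of_eq rfl rfl
  · refine (hpt r).of_eq rfl ?_
    show B + (r.val * 6 + 0) = B + (r.val * 6 + t.val); omega
  · refine (hpf r).of_eq rfl ?_
    show B + (r.val * 6 + 5) = B + (r.val * 6 + t.val); omega

/-! ### Numbering facts -/

/-- The cells of a site. [folklore] -/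
theorem cells_site' (r s : ℕ) : wIdx φ r s = blIdx φ r s + 1 ∧ brIdx φ r s = blIdx φ r s + 2 ∧
    blIdx φ r (s + 1) = blIdx φ r s + 2 := by
  unfold wIdx blIdx brIdx rowCell; omega

/-- Consecutive clause cells. [folklore] -/
theorem kIdx_eq (c : ℕ) : kIdx φ c = kIdx φ 0 + c := by unfold kIdx; omega

/-- The first cell of the next row follows `Bl_N`; `K_0` follows the last `Bl_N`. [folklore] -/
theorem next_row_cell {r : ℕ} (hr : r < N φ) :
    (if r + 1 < N φ then 5 * blIdx φ (r + 1) 0 else 5 * kIdx φ 0) = 5 * blIdx φ r (N φ) + 5 := by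
  split_ifs with h1
  · unfold blIdx rowCell; rw [rowStart_succ]; omega
  · unfold blIdx rowCell rowStart kIdx
    obtain rfl : r = N φ - 1 := by omega
    have : (N φ - 1) * (2 * N φ + 1) + (2 * N φ + 1) = N φ * (2 * N φ + 1) := by
      rw [← Nat.succ_mul]; congr 1; omega
    omega

/-- `hopBase` in terms of the site anchor. [folklore] -/
theorem hopBase_eq (c r h : ℕ) : hopBase φ c r h = base2 φ + 60 * (c * N φ + r) + 12 * h := by unfold hopBase; ring

/-! ### The hop ladders are drawn -/

/-- **Every edge of hop ladder `h` of column `c` in row `r` is drawn.** [folklore] -/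
theorem drawn_hop {c r h : ℕ} (hc : c < N φ) (hr : r < N φ) (hh : h < 5)
    {x y : RailV 2 4 4} (hxy : RailXOR.Γ.graph.Adj x y) :
    Drawn φ (railNum (K := 4) (hopBase φ c r h) (ends₂ (hopSlots' φ c r h)) x)
      (railNum (K := 4) (hopBase φ c r h) (ends₂ (hopSlots' φ c r h)) y) := by
  -- the site of the column in this row
  set s := J φ r c with hsdef
  have hs : s < N φ := J_lt hc
  have hJs : J φ r s = c := J_J hc
  have hA4 : siteAnchor φ r s 4 = base2 φ + 60 * (c * N φ + r) := by simp only [siteAnchor]; rw [hJs]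
  have hA2 : siteAnchor φ r s 2 = dlBase φ r s := rfl
  have hA0 : siteAnchor φ r s 0 = 5 * blIdx φ r s := rfl
  have hb := hopBase_eq (φ := φ) c r h
  obtain ⟨hw, -, -⟩ := cells_site' (φ := φ) r s
  -- bridges between the `J r c`-forms produced by unfolding and the abbreviation `s`
  have hJd : dlBase φ r (J φ r c) = dlBase φ r s := rfl
  have hJw : wIdx φ r (J φ r c) = wIdx φ r s := rfl
  have hJb : blIdx φ r (J φ r c) = blIdx φ r s := rfl
  by_cases h0 : h = 0
  · -- `h₀`: second rail, rungs at it and its second slot's ports in the site; first rail above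
    subst h0
    obtain ⟨f1, f2, f3, f4, -, -, -, -, -, -⟩ := F_h0 (sF1 s) (sF2 φ s) (sF3 φ r s) (sF4 φ r s) (sF5 φ r s)
    have e2 : (hopSlots' φ c r 0).2 = (dlBase φ r s + 8, dlBase φ r s + 9) := by
      unfold hopSlots'; rw [if_pos rfl]; unfold hopUL; rw [hJd]
    have e1 : (hopSlots' φ c r 0).1 = (above φ r c).swap := by unfold hopSlots'; rw [if_pos rfl]
    -- the upper tile: the dummy pair (`r = 0`) or the site above
    have upper : (∀ t < 3, Drawn φ (hopBase φ c r 0 + (0 * 4 + t)) (hopBase φ c r 0 + (0 * 4 + (t + 1)))) ∧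
        (∀ t < 4, Drawn φ (hopBase φ c r 0 + (0 * 4 + t)) (hopBase φ c r 0 + (8 + t))) ∧
        Drawn φ (above φ r c).2 (hopBase φ c r 0) ∧ Drawn φ (above φ r c).1 (hopBase φ c r 0 + 3) := by
      by_cases hr0 : r = 0
      · subst hr0
        obtain ⟨g1, g2, -⟩ := F_dummy (decide (c + 1 = N φ)) (prev? φ c).isNone
        obtain ⟨-, -, -, -, -, -, -, -, -, -, -, -, -, -, -, -, -, -, -, -, -, -, -, g3, g4, -⟩ :=
          mem_dummyEdges (decide (c + 1 = N φ)) (prev? φ c).isNone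
        have hD3 : dummyAnchor φ c 3 = hopBase φ c 0 0 := by simp only [dummyAnchor]; rw [hb]; ring
        have hD0 : dummyAnchor φ c 0 = 5 * (2 * c) := rfl
        have ea : above φ 0 c = (5 * (2 * c) + 1, 5 * (2 * c) + 3) := by unfold above; rw [if_pos rfl]; rfl
        refine ⟨fun t ht => dD hc (g1 t ht) (by omega) (by omega), fun t ht => dD hc (g2 t ht) (by omega) (by omega), ?_, ?_⟩
        · rw [ea]; exact dD hc g3 (by omega) (by omega)
        · rw [ea]; exact dD hc g4 (by omega) (by omega)
      · obtain ⟨r', rfl⟩ : ∃ r', r = r' + 1 := ⟨r - 1, by omega⟩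
        have hr' : r' < N φ := by omega
        set s' := J φ r' c with hs'def
        have hs' : s' < N φ := J_lt hc
        have hJs' : J φ r' s' = c := J_J hc
        have hA5 : siteAnchor φ r' s' 5 = hopBase φ c (r' + 1) 0 := by
          simp only [siteAnchor]; rw [if_pos hr, hJs', hb]; ring
        have hA0' : siteAnchor φ r' s' 0 = 5 * blIdx φ r' s' := rfl
        obtain ⟨hw', -, -⟩ := cells_site' (φ := φ) r' s'
        have hJw' : wIdx φ r' (J φ r' c) = wIdx φ r' s' := rfl
        have hJb' : blIdx φ r' (J φ r' c) = blIdx φ r' s' := rfl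
        obtain ⟨-, -, -, -, -, -, g1, g2, g3, g4⟩ := F_h0 (sF1 s') (sF2 φ s') (sF3 φ r' s') (sF4 φ r' s') (sF5 φ r' s')
        have ea : above φ (r' + 1) c = below φ r' c := by unfold above; rw [if_neg (by omega), Nat.add_sub_cancel]
        refine ⟨fun t ht => dS hr' hs' (g1 t ht) (by omega) (by omega), fun t ht => dS hr' hs' (g2 t ht) (by omega) (by omega), ?_, ?_⟩
        · rw [ea]; unfold below
          by_cases htap : IsTap φ r' c
          · rw [if_pos htap]
            have h3 : sF3 φ r' s' = true := by simp only [sF3, hJs', decide_eq_true_eq]; exact htap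
            exact dS hr' hs' (g3 h3).1 (by unfold slLR; simp only; omega) (by omega)
          · rw [if_neg htap]
            have h3 : sF3 φ r' s' = false := by simp only [sF3, hJs', decide_eq_false_iff_not]; exact htap
            exact dS hr' hs' (g4 h3).1 (by unfold slLL; simp only; omega) (by omega)
        · rw [ea]; unfold below
          by_cases htap : IsTap φ r' c
          · rw [if_pos htap]
            have h3 : sF3 φ r' s' = true := by simp only [sF3, hJs', decide_eq_true_eq]; exact htap
            exact dS hr' hs' (g3 h3).2 (by unfold slLR; simp only; omega) (by omega)
          · rw [if_neg htap]
            have h3 : sF3 φ r' s' = false := by simp only [sF3, hJs', decide_eq_false_iff_not]; exact htap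
            exact dS hr' hs' (g4 h3).2 (by unfold slLL; simp only; omega) (by omega)
    obtain ⟨u1, u2, u3, u4⟩ := upper
    refine drawn_xor (fun ρ hρ t ht => ?_) (fun ρ hρ t ht => ?_) ?_ ?_ ?_ ?_ hxy
    · rcases (show ρ = 0 ∨ ρ = 1 by omega) with rfl | rfl
      · exact u1 t ht
      · exact dS hr hs (f1 t ht) (by omega) (by omega)
    · rcases (show ρ = 0 ∨ ρ = 1 by omega) with rfl | rfl
      · exact u2 t ht
      · exact dS hr hs (f2 t ht) (by omega) (by omega)
    · rw [e1]; exact u3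
    · rw [e1]; exact u4
    · rw [e2]; exact dS hr hs f3 (by omega) (by omega)
    · rw [e2]; exact dS hr hs f4 (by omega) (by omega)
  · -- `h₁ … h₄`: everything in the site
    obtain ⟨H, rfl⟩ : ∃ H, h = H + 1 := ⟨h - 1, by omega⟩
    have hH : H < 4 := by omega
    obtain ⟨f1, f2, f3, f4, f5⟩ := F_hop (sF1 s) (sF2 φ s) (sF3 φ r s) (sF4 φ r s) (sF5 φ r s) hH
    have e1 : (hopSlots' φ c r (H + 1)).1 = (dlBase φ r s + (8 + 4 * H), dlBase φ r s + (10 + 4 * H)) := by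
      unfold hopSlots' hopSlots; rw [if_neg (by omega), if_neg (by omega)]
      split_ifs with h4
      · obtain rfl : H = 3 := by omega
        rfl
      · rw [Nat.add_sub_cancel]; rfl
    refine drawn_xor (fun ρ hρ t ht => dS hr hs (f1 ρ hρ t ht) (by omega) (by omega))
      (fun ρ hρ t ht => dS hr hs (f2 ρ hρ t ht) (by omega) (by omega)) ?_ ?_ ?_ ?_ hxy
    · rw [e1]; exact dS hr hs f3 (by simp only; omega) (by omega)
    · rw [e1]; exact dS hr hs f4 (by simp only; omega) (by omega)
    · by_cases h3 : H < 3
      · have e2 : (hopSlots' φ c r (H + 1)).2 = (dlBase φ r s + (12 + 4 * H), dlBase φ r s + (13 + 4 * H)) := by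
          unfold hopSlots' hopSlots; rw [if_neg (by omega), if_neg (by omega), if_neg (by omega)]
          unfold hopUL; simp only [Prod.mk.injEq]; omega
        rw [e2]; exact dS hr hs (f5 h3).1 (by simp only; omega) (by omega)
      · obtain rfl : H = 3 := by omega
        have e2 : (hopSlots' φ c r (3 + 1)).2 = (5 * wIdx φ r s + 1, 5 * wIdx φ r s + 2) := by
          unfold hopSlots' hopSlots; rw [if_neg (by omega), if_neg (by omega), if_pos rfl]; rfl
        obtain ⟨-, -, -, -, g5, -, -⟩ := F_h0 (sF1 s) (sF2 φ s) (sF3 φ r s) (sF4 φ r s) (sF5 φ r s)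
        rw [e2]; exact dS hr hs g5 (by simp only; omega) (by omega)
    · by_cases h3 : H < 3
      · have e2 : (hopSlots' φ c r (H + 1)).2 = (dlBase φ r s + (12 + 4 * H), dlBase φ r s + (13 + 4 * H)) := by
          unfold hopSlots' hopSlots; rw [if_neg (by omega), if_neg (by omega), if_neg (by omega)]
          unfold hopUL; simp only [Prod.mk.injEq]; omega
        rw [e2]; exact dS hr hs (f5 h3).2 (by simp only; omega) (by omega)
      · obtain rfl : H = 3 := by omega
        have e2 : (hopSlots' φ c r (3 + 1)).2 = (5 * wIdx φ r s + 1, 5 * wIdx φ r s + 2) := by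
          unfold hopSlots' hopSlots; rw [if_neg (by omega), if_neg (by omega), if_pos rfl]; rfl
        obtain ⟨-, -, -, -, -, g6, -⟩ := F_h0 (sF1 s) (sF2 φ s) (sF3 φ r s) (sF4 φ r s) (sF5 φ r s)
        rw [e2]; exact dS hr hs g6 (by simp only; omega) (by omega)


/-! ### The set ladders and the clause links are drawn -/

/-- **Every edge of the set ladder of column `c` is drawn.** [folklore] -/
theorem drawn_set {c : ℕ} (hc : c < N φ) {x y : RailV 2 4 4} (hxy : RailXOR.Γ.graph.Adj x y) :
    Drawn φ (railNum (K := 4) (setBase φ c) (ends₂ (setSlots' φ c)) x) (railNum (K := 4) (setBase φ c) (ends₂ (setSlots' φ c)) y) := by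
  cases hp : (prev? φ c).isSome
  · -- no previous occurrence: the vacuous set ladder under the pins of the dummy pair
    have hv : (prev? φ c).isNone = true := by cases h : prev? φ c <;> simp_all
    have ep : setSlots' φ c = (slLR (dIdx c), (slLL (d'Idx c)).swap) := by unfold setSlots'; rw [hp]; rfl
    obtain ⟨-, -, g⟩ := F_dummy (decide (c + 1 = N φ)) (prev? φ c).isNone
    obtain ⟨g1, g2, g3, g4, g5, g6⟩ := g hv
    have hD4 : dummyAnchor φ c 4 = setBase φ c := rfl
    have hD0 : dummyAnchor φ c 0 = 5 * (2 * c) := rfl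
    rw [ep]
    refine drawn_xor (fun ρ hρ t ht => dD hc (g1 ρ hρ t ht) (by omega) (by omega))
      (fun ρ hρ t ht => dD hc (g2 ρ hρ t ht) (by omega) (by omega)) ?_ ?_ ?_ ?_ hxy
    · exact dD hc g3 (by unfold slLR dIdx; simp only; omega) (by omega)
    · exact dD hc g4 (by unfold slLR dIdx; simp only; omega) (by omega)
    · exact dD hc g5 (by unfold slLL d'Idx; simp only [Prod.swap]; omega) (by omega)
    · exact dD hc g6 (by unfold slLL d'Idx; simp only [Prod.swap]; omega) (by omega)
  · -- the set ladder at the door of site `(c, J c c)`; its second rail in the next site (or, last site, the same)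
    set s := J φ c c with hsdef
    have hs : s < N φ := J_lt hc
    have ep : setSlots' φ c = (slLL (wIdx φ c s), (slLL (brIdx φ c s)).swap) := by unfold setSlots'; rw [hp]; rfl
    obtain ⟨hw, hbr, hbl⟩ := cells_site' (φ := φ) c s
    have h4 : sF4 φ c s = true := by simp only [sF4, hp, Bool.and_true, decide_eq_true_eq]; rfl
    have hA6 : siteAnchor φ c s 6 = setBase φ c := rfl
    have hA0 : siteAnchor φ c s 0 = 5 * blIdx φ c s := rfl
    obtain ⟨g, gg, -, g4⟩ := F_set (sF1 s) (sF2 φ s) (sF3 φ c s) (sF4 φ c s) (sF5 φ c s)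
    obtain ⟨g1, g2, g3a, g3b⟩ := g h4
    -- the second rail with its rungs and ports
    have second : (∀ t < 3, Drawn φ (setBase φ c + (1 * 4 + t)) (setBase φ c + (1 * 4 + (t + 1)))) ∧
        (∀ t < 4, Drawn φ (setBase φ c + (1 * 4 + t)) (setBase φ c + (8 + t))) ∧
        Drawn φ (5 * brIdx φ c s + 3) (setBase φ c + 4) ∧ Drawn φ (5 * brIdx φ c s + 1) (setBase φ c + 7) := by
      by_cases hl : s + 1 < N φ
      · -- in the next site, whose flag `s1` is set
        have h5 : sF5 φ c (s + 1) = true := by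
          simp only [sF5, hp, Bool.and_true, decide_eq_true_eq]; exact ⟨by omega, by rw [Nat.add_sub_cancel]⟩
        have hA6' : siteAnchor φ c (s + 1) 6 = setBase φ c := rfl
        have hA0' : siteAnchor φ c (s + 1) 0 = 5 * blIdx φ c (s + 1) := rfl
        obtain ⟨-, gg', g5', -⟩ := F_set (sF1 (s + 1)) (sF2 φ (s + 1)) (sF3 φ c (s + 1)) (sF4 φ c (s + 1)) (sF5 φ c (s + 1))
        obtain ⟨k1, k2⟩ := gg' (by rw [h5]; rfl)
        obtain ⟨k3, k4⟩ := g5' h5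
        exact ⟨fun t ht => dS hc hl (k1 t ht) (by omega) (by omega), fun t ht => dS hc hl (k2 t ht) (by omega) (by omega),
          dS hc hl k3 (by omega) (by omega), dS hc hl k4 (by omega) (by omega)⟩
      · -- the last site of the row
        have h2 : sF2 φ s = true := by simp only [sF2, decide_eq_true_eq]; omega
        obtain ⟨k1, k2⟩ := gg (by rw [h4, h2]; simp)
        obtain ⟨k3, k4⟩ := g4 (by rw [h4, h2]; rfl)
        exact ⟨fun t ht => dS hc hs (k1 t ht) (by omega) (by omega), fun t ht => dS hc hs (k2 t ht) (by omega) (by omega),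
          dS hc hs k3 (by omega) (by omega), dS hc hs k4 (by omega) (by omega)⟩
    obtain ⟨s1, s2, s3, s4⟩ := second
    rw [ep]
    refine drawn_xor (fun ρ hρ t ht => ?_) (fun ρ hρ t ht => ?_) ?_ ?_ ?_ ?_ hxy
    · rcases (show ρ = 0 ∨ ρ = 1 by omega) with rfl | rfl
      · exact dS hc hs (g1 t ht) (by omega) (by omega)
      · exact s1 t ht
    · rcases (show ρ = 0 ∨ ρ = 1 by omega) with rfl | rfl
      · exact dS hc hs (g2 t ht) (by omega) (by omega)
      · exact s2 t ht
    · exact dS hc hs g3a (by unfold slLL; simp only; omega) (by omega)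
    · exact dS hc hs g3b (by unfold slLL; simp only; omega) (by omega)
    · exact s3.of_eq (by unfold slLL; simp only [Prod.swap]) rfl
    · exact s4.of_eq (by unfold slLL; simp only [Prod.swap]) rfl

/-- **Every edge of the clause link of column `c` is drawn** (`N = 3T + 1`). [folklore] -/
theorem drawn_klink (hN : 0 < N φ) (hN3 : N φ = 3 * T φ + 1) {c : ℕ} (hc : c < N φ) {x y : RailV 2 4 4}
    (hxy : RailXOR.Γ.graph.Adj x y) :
    Drawn φ (railNum (K := 4) (klinkBase φ c) (ends₂ (klinkSlots' φ c)) x)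
      (railNum (K := 4) (klinkBase φ c) (ends₂ (klinkSlots' φ c)) y) := by
  -- the first rail and the exit ports in the last row's site of the column
  set r := N φ - 1 with hrdef
  have hr : r < N φ := by omega
  set s := J φ r c with hsdef
  have hs : s < N φ := J_lt hc
  have hJs : J φ r s = c := J_J hc
  have hA5 : siteAnchor φ r s 5 = klinkBase φ c := by
    simp only [siteAnchor]; rw [if_neg (by omega), hJs]; unfold klinkBase; ring
  have hA0 : siteAnchor φ r s 0 = 5 * blIdx φ r s := rfl
  have hJw : wIdx φ r (J φ r c) = wIdx φ r s := rfl
  have hJb : blIdx φ r (J φ r c) = blIdx φ r s := rfl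
  obtain ⟨hw, -, -⟩ := cells_site' (φ := φ) r s
  obtain ⟨-, -, -, -, -, -, g1, g2, g3, g4⟩ := F_h0 (sF1 s) (sF2 φ s) (sF3 φ r s) (sF4 φ r s) (sF5 φ r s)
  have e1 : (klinkSlots' φ c).1 = (below φ r c).swap := rfl
  have e2 : (klinkSlots' φ c).2 = (5 * kIdx φ c + 1, 5 * kIdx φ c + 2) := rfl
  -- the second rail in the tile of `K_c`
  have second : (∀ t < 3, Drawn φ (klinkBase φ c + (1 * 4 + t)) (klinkBase φ c + (1 * 4 + (t + 1)))) ∧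
      (∀ t < 4, Drawn φ (klinkBase φ c + (1 * 4 + t)) (klinkBase φ c + (8 + t))) ∧
      Drawn φ (5 * kIdx φ c + 1) (klinkBase φ c + 4) ∧ Drawn φ (5 * kIdx φ c + 2) (klinkBase φ c + 7) := by
    by_cases h0 : c = 0
    · subst h0
      obtain ⟨k1, k2⟩ := F_k0 (FormulaCells.polOf φ 0)
      obtain ⟨-, -, -, -, -, -, -, -, k3, k4, -⟩ := mem_k0Edges (FormulaCells.polOf φ 0)
      have hK1 : k0Anchor φ 1 = klinkBase φ 0 := rfl
      have hK0 : k0Anchor φ 0 = 5 * kIdx φ 0 := rfl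
      exact ⟨fun t ht => dK (k1 t ht) (by omega) (by omega), fun t ht => dK (k2 t ht) (by omega) (by omega),
        dK k3 (by omega) (by omega), dK k4 (by omega) (by omega)⟩
    · set t := (c - 1) / 3 with htdef
      set V := (c - 1) % 3 with hVdef
      have hcV : c = 3 * t + 1 + V := by omega
      have ht : t < T φ := by omega
      have hV : V < 3 := Nat.mod_lt _ (by omega)
      obtain ⟨-, -, -, -, -, -, k1, k2, k3, k4, -⟩ := F_clause (cPols φ t).1 (cPols φ t).2.1 (cPols φ t).2.2 hV
      have hC1 : clauseAnchor φ t 1 = klinkBase φ (3 * t + 1) := rfl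
      have hC0 : clauseAnchor φ t 0 = 5 * kIdx φ (3 * t + 1) := rfl
      have hkb : klinkBase φ c = klinkBase φ (3 * t + 1) + 12 * V := by unfold klinkBase; omega
      have hkc : kIdx φ c = kIdx φ (3 * t + 1) + V := by unfold kIdx; omega
      exact ⟨fun u hu => dC ht (k1 u hu) (by omega) (by omega), fun u hu => dC ht (k2 u hu) (by omega) (by omega),
        dC ht k3 (by omega) (by omega), dC ht k4 (by omega) (by omega)⟩
  obtain ⟨s1, s2, s3, s4⟩ := second
  refine drawn_xor (fun ρ hρ t ht => ?_) (fun ρ hρ t ht => ?_) ?_ ?_ ?_ ?_ hxy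
  · rcases (show ρ = 0 ∨ ρ = 1 by omega) with rfl | rfl
    · exact dS hr hs (g1 t ht) (by omega) (by omega)
    · exact s1 t ht
  · rcases (show ρ = 0 ∨ ρ = 1 by omega) with rfl | rfl
    · exact dS hr hs (g2 t ht) (by omega) (by omega)
    · exact s2 t ht
  · rw [e1]; unfold below
    by_cases htap : IsTap φ r c
    · rw [if_pos htap]
      have h3 : sF3 φ r s = true := by simp only [sF3, hJs, decide_eq_true_eq]; exact htap
      exact dS hr hs (g3 h3).1 (by unfold slLR; simp only [Prod.swap]; omega) (by omega)
    · rw [if_neg htap]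
      have h3 : sF3 φ r s = false := by simp only [sF3, hJs, decide_eq_false_iff_not]; exact htap
      exact dS hr hs (g4 h3).1 (by unfold slLL; simp only [Prod.swap]; omega) (by omega)
  · rw [e1]; unfold below
    by_cases htap : IsTap φ r c
    · rw [if_pos htap]
      have h3 : sF3 φ r s = true := by simp only [sF3, hJs, decide_eq_true_eq]; exact htap
      exact dS hr hs (g3 h3).2 (by unfold slLR; simp only [Prod.swap]; omega) (by omega)
    · rw [if_neg htap]
      have h3 : sF3 φ r s = false := by simp only [sF3, hJs, decide_eq_false_iff_not]; exact htap
      exact dS hr hs (g4 h3).2 (by unfold slLL; simp only [Prod.swap]; omega) (by omega)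
  · rw [e2]; exact s3
  · rw [e2]; exact s4

/-- **Every edge of every stage-2 gadget is drawn.** [folklore] -/
theorem drawn_placed₂ (hN3 : N φ = 3 * T φ + 1) {i : ℕ} (hi : i < n₂ φ) {a b : ℕ}
    (hab : (placed₂ φ i).GX.Adj a b) : Drawn φ a b := by
  obtain ⟨x, y, hxy, rfl, rfl⟩ := (placed₂_adj hi).1 hab
  by_cases h₁ : i < 5 * (N φ * N φ)
  · obtain ⟨hc, hr, hh, -⟩ := hop_idx_lt h₁
    have hsp : slotPair₂ φ i = hopSlots' φ (i / 5 / N φ) (i / 5 % N φ) (i % 5) := by unfold slotPair₂; rw [if_pos h₁]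
    have hb : base2 φ + 12 * i = hopBase φ (i / 5 / N φ) (i / 5 % N φ) (i % 5) := by
      have h1 := Nat.div_add_mod (i / 5) (N φ)
      have h2 := Nat.div_add_mod i 5
      unfold hopBase; rw [Nat.mul_comm (i / 5 / N φ) (N φ)]; omega
    rw [hsp, hb]; exact drawn_hop hc hr hh hxy
  by_cases h₂ : i < 5 * (N φ * N φ) + N φ
  · have hsp : slotPair₂ φ i = setSlots' φ (i - 5 * (N φ * N φ)) := by unfold slotPair₂; rw [if_neg h₁, if_pos h₂]
    have hb : base2 φ + 12 * i = setBase φ (i - 5 * (N φ * N φ)) := by unfold setBase; omega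
    rw [hsp, hb]; exact drawn_set (by omega) hxy
  · have hsp : slotPair₂ φ i = klinkSlots' φ (i - (5 * (N φ * N φ) + N φ)) := by unfold slotPair₂; rw [if_neg h₁, if_neg h₂]
    have hb : base2 φ + 12 * i = klinkBase φ (i - (5 * (N φ * N φ) + N φ)) := by unfold klinkBase; omega
    rw [hsp, hb]; exact drawn_klink (by omega) hN3 (by unfold n₂ at hi; omega) hxy

/-! ### The diamond ladders are drawn -/

set_option maxRecDepth 20000 in
/-- **The edges of the diamond-ladder template, classified** (by `decide`): rails, the diamonds
with their attachments, the four port edges. [folklore] -/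
theorem dl_edge_cases : ∀ e ∈ DiamondLadder.edges,
    (e.2.val = e.1.val + 1 ∧ (e.1.val < 3 ∨ (4 ≤ e.1.val ∧ e.1.val < 7))) ∨
    (∃ k : Fin 4, (e.1.val = k.val ∧ e.2.val = 8 + 4 * k.val) ∨ (e.1.val = 8 + 4 * k.val ∧ e.2.val = 9 + 4 * k.val) ∨
      (e.1.val = 8 + 4 * k.val ∧ e.2.val = 10 + 4 * k.val) ∨ (e.1.val = 9 + 4 * k.val ∧ e.2.val = 10 + 4 * k.val) ∨
      (e.1.val = 9 + 4 * k.val ∧ e.2.val = 11 + 4 * k.val) ∨ (e.1.val = 10 + 4 * k.val ∧ e.2.val = 11 + 4 * k.val) ∨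
      (e.1.val = 11 + 4 * k.val ∧ e.2.val = 4 + k.val)) ∨
    (e.1.val = 24 ∧ e.2.val = 0) ∨ (e.1.val = 25 ∧ e.2.val = 3) ∨ (e.1.val = 26 ∧ e.2.val = 4) ∨ (e.1.val = 27 ∧ e.2.val = 7) := by
  decide

/-- From value pairs back to the edge list of the diamond ladder. [folklore] -/
theorem dl_mem_edges_of_vals {x y : Fin 28} (h : (x.val, y.val) ∈ dlEdgesN) : (x, y) ∈ DiamondLadder.edges := by
  unfold dlEdgesN at h
  obtain ⟨e, he, hxy⟩ := List.mem_map.1 h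
  simp only [Prod.mk.injEq] at hxy
  obtain rfl : e = (x, y) := Prod.ext (Fin.ext hxy.1) (Fin.ext hxy.2)
  exact he

/-- **Every listed edge of the diamond ladder of site `(r, s)` that is not a hop slot is drawn**
(inner vertices in the site's tile, the second rail and the ports at `Br` in the next tile — or in
the same tile at the last site). [folklore] -/
theorem drawn_dl {r s : ℕ} (hr : r < N φ) (hs : s < N φ) {x y : Fin 28} (hxy : (x, y) ∈ DiamondLadder.edges)
    (hns : (dlNum φ (r * N φ + s) x, dlNum φ (r * N φ + s) y) ∉ SB₂ φ) :
    Drawn φ (dlNum φ (r * N φ + s) x) (dlNum φ (r * N φ + s) y) := by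
  have hA2 : siteAnchor φ r s 2 = dlBase φ r s := rfl
  have hA0 : siteAnchor φ r s 0 = 5 * blIdx φ r s := rfl
  obtain ⟨hw, hbr, hbl⟩ := cells_site' (φ := φ) r s
  obtain ⟨f1, f2, f3, f4, f5, f6⟩ := F_dl (sF1 s) (sF2 φ s) (sF3 φ r s) (sF4 φ r s) (sF5 φ r s)
  -- the second rail `w`, the joins `q_k – w_k` and the ports at `Br`: next tile or last site
  have W : (∀ u, 4 ≤ u → u < 7 → Drawn φ (dlBase φ r s + u) (dlBase φ r s + (u + 1))) ∧
      (∀ k < 4, Drawn φ (dlBase φ r s + (11 + 4 * k)) (dlBase φ r s + (4 + k))) ∧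
      Drawn φ (5 * blIdx φ r (s + 1) + 2) (dlBase φ r s + 4) ∧ Drawn φ (5 * blIdx φ r (s + 1) + 1) (dlBase φ r s + 7) := by
    by_cases hl : s + 1 < N φ
    · have hf : sF1 (s + 1) = false := by simp [sF1]
      have hA3' : siteAnchor φ r (s + 1) 3 = dlBase φ r s := by simp only [siteAnchor]; rw [Nat.add_sub_cancel]
      have hA0' : siteAnchor φ r (s + 1) 0 = 5 * blIdx φ r (s + 1) := rfl
      obtain ⟨-, -, -, -, g5, -⟩ := F_dl (sF1 (s + 1)) (sF2 φ (s + 1)) (sF3 φ r (s + 1)) (sF4 φ r (s + 1)) (sF5 φ r (s + 1))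
      obtain ⟨k1, k2, k3, k4⟩ := g5 hf
      refine ⟨fun u hu hu' => dS hr hl (k1 (u - 4) (by omega)) (by omega) (by omega),
        fun k hk => (dS hr hl (k2 k hk) rfl rfl).symm.of_eq (by omega) (by omega), dS hr hl k4 (by omega) (by omega),
        dS hr hl k3 (by omega) (by omega)⟩
    · have h2 : sF2 φ s = true := by simp only [sF2, decide_eq_true_eq]; omega
      obtain ⟨k1, k2, k3, k4, -⟩ := f6 h2
      refine ⟨fun u hu hu' => dS hr hs (k1 (u - 4) (by omega)) (by omega) (by omega),
        fun k hk => (dS hr hs (k2 k hk) rfl rfl).symm.of_eq (by omega) (by omega), dS hr hs k4 (by omega) (by omega),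
        dS hr hs k3 (by omega) (by omega)⟩
  obtain ⟨w1, w2, w3, w4⟩ := W
  have ex := dlNum_eq hr hs x
  have ey := dlNum_eq hr hs y
  have hcl := dl_edge_cases (x, y) hxy
  simp only at hcl
  rcases hcl with ⟨hv, hu | hu⟩ | ⟨k, hk⟩ | ⟨hu, hv⟩ | ⟨hu, hv⟩ | ⟨hu, hv⟩ | ⟨hu, hv⟩
  · -- the first rail `v`
    rw [if_pos (by omega)] at ex; rw [if_pos (by omega)] at ey; rw [ex, ey, hv]
    exact dS hr hs (f1 x.val hu) (by omega) (by omega)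
  · -- the second rail `w`
    rw [if_pos (by omega)] at ex; rw [if_pos (by omega)] at ey; rw [ex, ey, hv]
    exact w1 x.val hu.1 hu.2
  · -- the diamonds
    have hk4 := k.isLt
    rcases hk with ⟨hu, hv⟩ | ⟨hu, hv⟩ | ⟨hu, hv⟩ | ⟨hu, hv⟩ | ⟨hu, hv⟩ | ⟨hu, hv⟩ | ⟨hu, hv⟩ <;>
      rw [if_pos (by omega)] at ex <;> rw [if_pos (by omega)] at ey <;> rw [ex, ey, hu, hv] <;> rw [ex, ey, hu, hv] at hns
    · exact dS hr hs (f2 k.val hk4).1 (by omega) (by omega)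
    · exact absurd (hop_mem_SB₂ hr hs hk4).1 hns
    · exact absurd (hop_mem_SB₂ hr hs hk4).2 hns
    · exact dS hr hs (f2 k.val hk4).2.1 (by omega) (by omega)
    · exact dS hr hs (f2 k.val hk4).2.2.1 (by omega) (by omega)
    · exact dS hr hs (f2 k.val hk4).2.2.2 (by omega) (by omega)
    · exact w2 k.val hk4
  · -- `a(Bl) – v₀`
    rw [if_neg (by omega), if_pos hu] at ex; rw [if_pos (by omega)] at ey; rw [ex, ey, hv]
    exact dS hr hs f3 (by omega) (by omega)
  · -- `q(Bl) – v₃`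
    rw [if_neg (by omega), if_neg (by omega), if_pos hu] at ex; rw [if_pos (by omega)] at ey; rw [ex, ey, hv]
    exact dS hr hs f4 (by omega) (by omega)
  · -- `a(Br) – w₀`
    rw [if_neg (by omega), if_neg (by omega), if_neg (by omega), if_pos hu] at ex; rw [if_pos (by omega)] at ey; rw [ex, ey, hv]
    exact w3
  · -- `p(Br) – w₃`
    rw [if_neg (by omega), if_neg (by omega), if_neg (by omega), if_neg (by omega)] at ex; rw [if_pos (by omega)] at ey; rw [ex, ey, hv]
    exact w4

/-! ### The pins, the unit-clause gadget and the clause gadgets are drawn -/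

/-- **Every edge of the pin on dummy cell `d` is drawn.** [folklore] -/
theorem drawn_pin {d : ℕ} (hd : d < 2 * N φ) {x y : RailV 1 2 1} (hxy : RailOR1.Γ.graph.Adj x y) :
    Drawn φ (railNum (K := 2) (pinBase φ d) (fun _ => slUL d) x) (railNum (K := 2) (pinBase φ d) (fun _ => slUL d) y) := by
  set c := d / 2 with hcdef
  have hc : c < N φ := by omega
  have hD2 : dummyAnchor φ c 2 = pinBase φ (2 * c) := rfl
  have hD0 : dummyAnchor φ c 0 = 5 * (2 * c) := rfl
  have hps := pinBase_succ (φ := φ) c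
  obtain ⟨-, -, -, -, -, -, -, -, -, -, -, g1, g2, g3, g4, g5, g6, g7, g8, g9, g10, -⟩ := mem_dummyEdges (decide (c + 1 = N φ)) (prev? φ c).isNone
  rcases Nat.even_or_odd' d with ⟨c', hc' | hc'⟩ <;> obtain rfl : c = c' := by omega
  · rw [hc']
    exact drawn_or1 (dD hc g1 (by omega) (by omega)) (dD hc g2 (by omega) (by omega)) (dD hc g3 (by omega) (by omega))
      (dD hc g7 (by unfold slUL; simp only; omega) (by omega)) (dD hc g8 (by unfold slUL; simp only; omega) (by omega)) hxy
  · rw [hc', hps]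
    exact drawn_or1 (dD hc g4 (by omega) (by omega)) (dD hc g5 (by omega) (by omega)) (dD hc g6 (by omega) (by omega))
      (dD hc g9 (by unfold slUL; simp only; omega) (by omega)) (dD hc g10 (by unfold slUL; simp only; omega) (by omega)) hxy

/-- **Every edge of the unit-clause gadget is drawn.** [folklore] -/
theorem drawn_cl1 {x y : RailV 1 2 1} (hxy : RailOR1.Γ.graph.Adj x y) :
    Drawn φ (railNum (K := 2) (clause1Base φ) (fun _ => litSlot φ 0) x) (railNum (K := 2) (clause1Base φ) (fun _ => litSlot φ 0) y) := by
  have hK2 : k0Anchor φ 2 = clause1Base φ := rfl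
  have hK0 : k0Anchor φ 0 = 5 * kIdx φ 0 := rfl
  obtain ⟨-, -, -, -, g5, g6, -, -, -, -, g1, g2, g3⟩ := mem_k0Edges (FormulaCells.polOf φ 0)
  refine drawn_or1 (dK g1 (by omega) (by omega)) (dK g2 (by omega) (by omega)) (dK g3 (by omega) (by omega)) ?_ ?_ hxy
  · unfold litSlot
    cases hp : FormulaCells.polOf φ 0
    · rw [if_neg Bool.false_ne_true]; exact dK (g6 hp).2.1 (by unfold slLR; simp only; omega) (by omega)
    · rw [if_pos rfl]; exact dK (g5 hp).2.1 (by unfold slLL; simp only; omega) (by omega)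
  · unfold litSlot
    cases hp : FormulaCells.polOf φ 0
    · rw [if_neg Bool.false_ne_true]; exact dK (g6 hp).2.2 (by unfold slLR; simp only; omega) (by omega)
    · rw [if_pos rfl]; exact dK (g5 hp).2.2 (by unfold slLL; simp only; omega) (by omega)

/-- The polarity selected by the clause tile for rail `ρ`. [folklore] -/
theorem cPols_sel (t : ℕ) (ρ : Fin 3) :
    (if ρ.val = 0 then (cPols φ t).1 else if ρ.val = 1 then (cPols φ t).2.1 else (cPols φ t).2.2) =
      FormulaCells.polOf φ (3 * t + 1 + ρ.val) := by
  rcases fin3_cases ρ with rfl | rfl | rfl <;> rfl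

/-- **Every edge of the gadget of three-literal clause `t` is drawn.** [folklore] -/
theorem drawn_or3' {t : ℕ} (ht : t < T φ) {x y : RailV 3 6 9} (hxy : RailOR3.Γ.graph.Adj x y) :
    Drawn φ (railNum (K := 6) (or3Base φ t) (fun r => litSlot φ (3 * t + 1 + r.val)) x)
      (railNum (K := 6) (or3Base φ t) (fun r => litSlot φ (3 * t + 1 + r.val)) y) := by
  have hC2 : clauseAnchor φ t 2 = or3Base φ t := rfl
  have hC0 : clauseAnchor φ t 0 = 5 * kIdx φ (3 * t + 1) := rfl
  have hkc : ∀ V, kIdx φ (3 * t + 1 + V) = kIdx φ (3 * t + 1) + V := fun V => by unfold kIdx; omega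
  obtain ⟨grungs, -⟩ := mem_clauseEdges_rungs (cPols φ t).1 (cPols φ t).2.1 (cPols φ t).2.2
  refine drawn_or3 (fun ρ hρ u hu => ?_) (fun ρ => ?_) (fun ρ => ?_) (fun ρ => ?_) hxy
  · obtain ⟨-, -, -, -, -, -, -, -, -, -, k⟩ := F_clause (cPols φ t).1 (cPols φ t).2.1 (cPols φ t).2.2 hρ
    exact dC ht (k u hu) (by omega) (by omega)
  · obtain ⟨k1, k2⟩ := grungs ρ
    have hsp := or3Rungs_spec ρ
    rw [← hsp] at k1 k2
    exact ⟨dC ht k1 rfl rfl, dC ht k2 rfl rfl⟩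
  · obtain ⟨-, -, -, -, k5, k6, -⟩ := F_clause (cPols φ t).1 (cPols φ t).2.1 (cPols φ t).2.2 ρ.isLt
    rw [cPols_sel] at k5 k6
    have hk := hkc ρ.val
    unfold litSlot
    cases hp : FormulaCells.polOf φ (3 * t + 1 + ρ.val)
    · rw [if_neg Bool.false_ne_true]; exact dC ht (k6 hp).2.1 (by unfold slLR; simp only; omega) (by omega)
    · rw [if_pos rfl]; exact dC ht (k5 hp).2.1 (by unfold slLL; simp only; omega) (by omega)
  · obtain ⟨-, -, -, -, k5, k6, -⟩ := F_clause (cPols φ t).1 (cPols φ t).2.1 (cPols φ t).2.2 ρ.isLt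
    rw [cPols_sel] at k5 k6
    have hk := hkc ρ.val
    unfold litSlot
    cases hp : FormulaCells.polOf φ (3 * t + 1 + ρ.val)
    · rw [if_neg Bool.false_ne_true]; exact dC ht (k6 hp).2.2 (by unfold slLR; simp only; omega) (by omega)
    · rw [if_pos rfl]; exact dC ht (k5 hp).2.2 (by unfold slLL; simp only; omega) (by omega)

/-- **Every edge of every stage-1 gadget that is not a stage-2 slot is drawn.** [folklore] -/
theorem drawn_placed₁ {i : ℕ} (hi : i < n₁ φ) {a b : ℕ}
    (hab : (placed₁ φ i).GX.Adj a b) (hns : (a, b) ∉ SB₂ φ ∧ (b, a) ∉ SB₂ φ) : Drawn φ a b := by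
  by_cases h₁ : i < N φ * N φ
  · obtain ⟨x, y, hxy, rfl, rfl⟩ := (placed₁_adj_dl h₁).1 hab
    obtain ⟨r, s, hr, hs, rfl⟩ : ∃ r s, r < N φ ∧ s < N φ ∧ i = r * N φ + s :=
      ⟨i / N φ, i % N φ, Nat.div_lt_of_lt_mul h₁, Nat.mod_lt _ (Nat.pos_of_ne_zero fun h0 => by simp [h0] at h₁),
        (Nat.div_add_mod' i (N φ)).symm⟩
    rcases DiamondLadder.mem_edges_of_adj x y hxy with h | h
    · exact drawn_dl hr hs (dl_mem_edges_of_vals h) hns.1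
    · exact (drawn_dl hr hs (dl_mem_edges_of_vals h) hns.2).symm
  by_cases h₂ : i < N φ * N φ + 2 * N φ
  · obtain ⟨x, y, hxy, rfl, rfl⟩ := (placed₁_adj_pin (not_lt.1 h₁) h₂).1 hab
    exact drawn_pin (by omega) hxy
  by_cases h₃ : i = N φ * N φ + 2 * N φ
  · subst h₃
    obtain ⟨x, y, hxy, rfl, rfl⟩ := placed₁_adj_cl1.1 hab
    exact drawn_cl1 hxy
  · obtain ⟨x, y, hxy, rfl, rfl⟩ := (placed₁_adj_or3 (by omega) hi).1 hab
    exact drawn_or3' (by unfold n₁ at hi; omega) hxy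

/-! ### Slots, for ruling out the chain edges that were removed -/

/-- The slots of the hop ladders are stage-2 slots. [folklore] -/
theorem hopSlots'_mem_SB₂ {c r h : ℕ} (hc : c < N φ) (hr : r < N φ) (hh : h < 5) :
    (hopSlots' φ c r h).1 ∈ SB₂ φ ∧ (hopSlots' φ c r h).2 ∈ SB₂ φ :=
  ⟨mem_SB₂_iff.2 (Or.inl ⟨c, r, h, hc, hr, hh, Or.inl rfl⟩), mem_SB₂_iff.2 (Or.inl ⟨c, r, h, hc, hr, hh, Or.inr rfl⟩)⟩

/-- The slots of the set ladders are stage-2 slots. [folklore] -/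
theorem setSlots'_mem_SB₂ {c : ℕ} (hc : c < N φ) : (setSlots' φ c).1 ∈ SB₂ φ ∧ (setSlots' φ c).2 ∈ SB₂ φ :=
  ⟨mem_SB₂_iff.2 (Or.inr (Or.inl ⟨c, hc, Or.inl rfl⟩)), mem_SB₂_iff.2 (Or.inr (Or.inl ⟨c, hc, Or.inr rfl⟩))⟩

/-- The slots of the clause links are stage-2 slots. [folklore] -/
theorem klinkSlots'_mem_SB₂ {c : ℕ} (hc : c < N φ) : (klinkSlots' φ c).1 ∈ SB₂ φ ∧ (klinkSlots' φ c).2 ∈ SB₂ φ :=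
  ⟨mem_SB₂_iff.2 (Or.inr (Or.inr ⟨c, hc, Or.inl rfl⟩)), mem_SB₂_iff.2 (Or.inr (Or.inr ⟨c, hc, Or.inr rfl⟩))⟩

/-- The reversed exit slot of a row is a stage-2 slot (of `h₀` of the next row, or of the clause link). [folklore] -/
theorem below_swap_mem_SB₂ {r c : ℕ} (hr : r < N φ) (hc : c < N φ) : (below φ r c).swap ∈ SB₂ φ := by
  by_cases h : r + 1 < N φ
  · have e : above φ (r + 1) c = below φ r c := by unfold above; rw [if_neg (by omega), Nat.add_sub_cancel]
    rw [← e]; exact above_swap_mem_SB₂ h hc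
  · have e : (klinkSlots' φ c).1 = (below φ r c).swap := by unfold klinkSlots'; rw [show N φ - 1 = r by omega]
    rw [← e]; exact (klinkSlots'_mem_SB₂ hc).1

/-- A slot is not an edge that survived: the contradiction. [folklore] -/
theorem slot_absurd {S : Finset (ℕ × ℕ)} {e : ℕ × ℕ} {a b : ℕ} (he : e ∈ S) (hn : (a, b) ∉ S) (h1 : e.1 = a) (h2 : e.2 = b) :
    False :=
  hn (by rw [← h1, ← h2]; exact he)

/-! ### The surviving chain edges are drawn -/

/-- The directed edge patterns of the chain (`c p`, `p a`, `p b`, `a b`, `a q`, `b q`, `q c'`). [folklore] -/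
abbrev ChainPat (a b : ℕ) : Prop :=
  (a % 5 = 0 ∧ b = a + 1) ∨ (a % 5 = 1 ∧ (b = a + 1 ∨ b = a + 2)) ∨ (a % 5 = 2 ∧ (b = a + 1 ∨ b = a + 2)) ∨
    (a % 5 = 3 ∧ b = a + 1) ∨ (a % 5 = 4 ∧ b = a + 1)

/-- **Classification of the cells**: dummies, bus and door cells of the sites, the row ends `Bl_N`,
the clause cells, the end cell. [folklore] -/
theorem cell_cases (hN : 0 < N φ) {i : ℕ} (hi : i < M φ) :
    (∃ c < N φ, i = dIdx c ∨ i = d'Idx c) ∨ (∃ r < N φ, ∃ s < N φ, i = blIdx φ r s ∨ i = wIdx φ r s) ∨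
      (∃ r < N φ, i = blIdx φ r (N φ)) ∨ (∃ c < N φ, i = kIdx φ c) ∨ i = zIdx φ := by
  by_cases h1 : i < 2 * N φ
  · exact Or.inl ⟨i / 2, by omega, by unfold dIdx d'Idx; omega⟩
  by_cases h2 : i < 2 * N φ + N φ * (2 * N φ + 1)
  · set r := (i - 2 * N φ) / (2 * N φ + 1) with hr
    set k := (i - 2 * N φ) % (2 * N φ + 1) with hk
    have hdm := Nat.div_add_mod' (i - 2 * N φ) (2 * N φ + 1)
    have hi' : i = rowCell φ r k := by unfold rowCell rowStart; rw [hr, hk]; omega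
    have hrN : r < N φ := by
      by_contra hge
      have := Nat.mul_le_mul_right (2 * N φ + 1) (not_lt.1 hge)
      rw [hr] at this; omega
    have hkN : k ≤ 2 * N φ := by rw [hk]; have := Nat.mod_lt (i - 2 * N φ) (show 0 < 2 * N φ + 1 by omega); omega
    by_cases h3 : k = 2 * N φ
    · exact Or.inr (Or.inr (Or.inl ⟨r, hrN, by rw [hi', h3]; rfl⟩))
    · refine Or.inr (Or.inl ⟨r, hrN, k / 2, by omega, ?_⟩)
      rw [hi']; unfold blIdx wIdx rowCell; omega
  by_cases h4 : i < zIdx φ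
  · refine Or.inr (Or.inr (Or.inr (Or.inl ⟨i - kIdx φ 0, by unfold zIdx at h4; unfold kIdx; omega, ?_⟩)))
    unfold kIdx; unfold kIdx zIdx at *; omega
  · have hz : i = zIdx φ := by have := zIdx_lt (φ := φ); unfold zIdx M at *; omega
    exact Or.inr (Or.inr (Or.inr (Or.inr hz)))

section chain

variable {a b : ℕ}

/-- **The surviving chain edges of a dummy pair are drawn.** [folklore] -/
theorem drawn_chain_dummy (hN : 0 < N φ) {c : ℕ} (hc : c < N φ) (hi : a / 5 = dIdx c ∨ a / 5 = d'Idx c)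
    (hpat : ChainPat a b) (h1 : (a, b) ∉ SB₁ φ ∧ (b, a) ∉ SB₁ φ) (h2 : (a, b) ∉ SB₂ φ ∧ (b, a) ∉ SB₂ φ) : Drawn φ a b := by
  have hD0 : dummyAnchor φ c 0 = 5 * (2 * c) := rfl
  have hD1 : dummyAnchor φ c 1 = 5 * blIdx φ 0 0 := rfl
  obtain ⟨g1, g2, g3, g4, g5, g6, g7, g8, g9, g10, g11, -⟩ := mem_dummyEdges (decide (c + 1 = N φ)) (prev? φ c).isNone
  unfold dIdx d'Idx at hi
  rcases hi with hi | hi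
  · -- the cell `D_c`
    rcases hpat with ⟨ho, rfl⟩ | ⟨ho, rfl | rfl⟩ | ⟨ho, rfl | rfl⟩ | ⟨ho, rfl⟩ | ⟨ho, rfl⟩
    · exact dD hc g1 (by omega) (by omega)
    · exact (slot_absurd (pin_slot_mem_SB₁ (d := 2 * c) (by omega)) h1.1 (by unfold slUL; simp only; omega)
        (by unfold slUL; simp only; omega)).elim
    · have e : above φ 0 c = (a, a + 2) := by unfold above; rw [if_pos rfl]; unfold slLL dIdx; simp only [Prod.mk.injEq]; omega
      exact (slot_absurd (above_swap_mem_SB₂ hN hc) h2.2 (by rw [e]; rfl) (by rw [e]; rfl)).elim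
    · exact dD hc g2 (by omega) (by omega)
    · exact dD hc g3 (by omega) (by omega)
    · cases hv : (prev? φ c).isNone
      · exact dD hc (g9 hv).1 (by omega) (by omega)
      · have e : (setSlots' φ c).1 = (a, a + 1) := by
          unfold setSlots'; rw [show (prev? φ c).isSome = false by cases h : prev? φ c <;> simp_all]
          unfold slLR dIdx; simp only [Bool.false_eq_true, ↓reduceIte, Prod.mk.injEq]; omega
        exact (slot_absurd (setSlots'_mem_SB₂ hc).1 h2.1 (by rw [e]) (by rw [e])).elim
    · exact dD hc g4 (by omega) (by omega)
  · -- the cell `D'_c`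
    rcases hpat with ⟨ho, rfl⟩ | ⟨ho, rfl | rfl⟩ | ⟨ho, rfl | rfl⟩ | ⟨ho, rfl⟩ | ⟨ho, rfl⟩
    · exact dD hc g5 (by omega) (by omega)
    · exact (slot_absurd (pin_slot_mem_SB₁ (d := 2 * c + 1) (by omega)) h1.1 (by unfold slUL; simp only; omega)
        (by unfold slUL; simp only; omega)).elim
    · cases hv : (prev? φ c).isNone
      · exact dD hc (g9 hv).2 (by omega) (by omega)
      · have e : (setSlots' φ c).2 = (a + 2, a) := by
          unfold setSlots'; rw [show (prev? φ c).isSome = false by cases h : prev? φ c <;> simp_all]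
          unfold slLL d'Idx; simp only [Bool.false_eq_true, ↓reduceIte, Prod.swap, Prod.mk.injEq]; omega
        exact (slot_absurd (setSlots'_mem_SB₂ hc).2 h2.2 (by rw [e]) (by rw [e])).elim
    · exact dD hc g6 (by omega) (by omega)
    · exact dD hc g7 (by omega) (by omega)
    · exact dD hc g8 (by omega) (by omega)
    · cases hl : decide (c + 1 = N φ)
      · exact dD hc (g11 hl) (by omega) (by omega)
      · have : blIdx φ 0 0 = 2 * c + 2 := by simp only [decide_eq_true_eq] at hl; unfold blIdx rowCell rowStart; omega
        exact dD hc (g10 hl) (by omega) (by omega)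

/-- **The surviving chain edges of a bus cell `Bl` are drawn.** [folklore] -/
theorem drawn_chain_bl {r s : ℕ} (hr : r < N φ) (hs : s < N φ) (hi : a / 5 = blIdx φ r s)
    (hpat : ChainPat a b) (h1 : (a, b) ∉ SB₁ φ ∧ (b, a) ∉ SB₁ φ) (h2 : (a, b) ∉ SB₂ φ ∧ (b, a) ∉ SB₂ φ) : Drawn φ a b := by
  have hA0 : siteAnchor φ r s 0 = 5 * blIdx φ r s := rfl
  obtain ⟨hw, hbr, hbl⟩ := cells_site' (φ := φ) r s
  obtain ⟨g1, g2, g3, -, -, -, -, -, g9, g10, g11, -⟩ := mem_siteEdges_chain (sF1 s) (sF2 φ s) (sF3 φ r s) (sF4 φ r s) (sF5 φ r s)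
  rcases hpat with ⟨ho, rfl⟩ | ⟨ho, rfl | rfl⟩ | ⟨ho, rfl | rfl⟩ | ⟨ho, rfl⟩ | ⟨ho, rfl⟩
  · exact dS hr hs g1 (by omega) (by omega)
  · -- `p – a`: drawn at the first site, the reversed slot of the previous ladder otherwise
    by_cases hs0 : s = 0
    · have hf : sF1 s = true := by simp [sF1, hs0]
      exact dS hr hs (g9 hf) (by omega) (by omega)
    · have hsl := (dl_slots_mem_SB₁ (φ := φ) hr (s := s - 1) (by omega)).2
      rw [brIdx_eq, show s - 1 + 1 = s by omega] at hsl
      exact (slot_absurd hsl h1.2 (by unfold slULrev; simp only; omega) (by unfold slULrev; simp only; omega)).elim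
  · -- `p – b`: the second set slot if `s1`
    cases h5 : sF5 φ r s
    · exact dS hr hs (g10 h5) (by omega) (by omega)
    · have h5' : (1 ≤ s ∧ s - 1 = J φ r r) ∧ (prev? φ r).isSome = true := by simpa [sF5] using h5
      have e : (setSlots' φ r).2 = (a + 2, a) := by
        unfold setSlots'; rw [if_pos h5'.2, brIdx_eq, show J φ r r + 1 = s by omega]
        unfold slLL; simp only [Prod.swap, Prod.mk.injEq]; omega
      exact (slot_absurd (setSlots'_mem_SB₂ hr).2 h2.2 (by rw [e]) (by rw [e])).elim
  · exact dS hr hs g2 (by omega) (by omega)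
  · -- `a – q` is the slot of the site's diamond ladder
    exact (slot_absurd (dl_slots_mem_SB₁ hr hs).1 h1.1 (by unfold slUR; simp only; omega) (by unfold slUR; simp only; omega)).elim
  · -- `b – q`: the tap slot if the column taps here
    cases h3 : sF3 φ r s
    · exact dS hr hs (g11 h3) (by omega) (by omega)
    · have ht : IsTap φ r (J φ r s) := by simpa [sF3] using h3
      have e : below φ r (J φ r s) = (a, a + 1) := by
        unfold below; rw [if_pos ht, J_J hs]; unfold slLR; simp only [Prod.mk.injEq]; omega
      exact (slot_absurd (below_swap_mem_SB₂ hr (J_lt hs)) h2.2 (by rw [e]; rfl) (by rw [e]; rfl)).elim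
  · exact dS hr hs g3 (by omega) (by omega)

/-- **The surviving chain edges of a door cell `W` are drawn.** [folklore] -/
theorem drawn_chain_w {r s : ℕ} (hr : r < N φ) (hs : s < N φ) (hi : a / 5 = wIdx φ r s)
    (hpat : ChainPat a b) (h2 : (a, b) ∉ SB₂ φ ∧ (b, a) ∉ SB₂ φ) : Drawn φ a b := by
  have hA0 : siteAnchor φ r s 0 = 5 * blIdx φ r s := rfl
  obtain ⟨hw, hbr, hbl⟩ := cells_site' (φ := φ) r s
  obtain ⟨-, -, -, g4, g5, g6, g7, g8, -, -, -, g12⟩ := mem_siteEdges_chain (sF1 s) (sF2 φ s) (sF3 φ r s) (sF4 φ r s) (sF5 φ r s)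
  rcases hpat with ⟨ho, rfl⟩ | ⟨ho, rfl | rfl⟩ | ⟨ho, rfl | rfl⟩ | ⟨ho, rfl⟩ | ⟨ho, rfl⟩
  · exact dS hr hs g4 (by omega) (by omega)
  · -- `p – a` of the door is the second slot of `h₄`
    have e : (hopSlots' φ (J φ r s) r 4).2 = (a, a + 1) := by
      unfold hopSlots' hopSlots; rw [if_neg (by omega), if_neg (by omega), if_pos rfl, J_J hs]
      unfold slUL; simp only [Prod.mk.injEq]; omega
    exact (slot_absurd (hopSlots'_mem_SB₂ (h := 4) (J_lt hs) hr (by omega)).2 h2.1 (by rw [e]) (by rw [e])).elim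
  · -- `p – b` of the door: the exit slot (no tap), the first set slot (`s0`), or drawn
    by_cases ht : IsTap φ r (J φ r s)
    · cases h4 : sF4 φ r s
      · have h3 : sF3 φ r s = true := by simpa [sF3] using ht
        have : (sF3 φ r s && !sF4 φ r s) = true := by rw [h3, h4]; rfl
        exact dS hr hs (g12 this) (by omega) (by omega)
      · have h4' : s = J φ r r ∧ (prev? φ r).isSome = true := by simpa [sF4] using h4
        have e : (setSlots' φ r).1 = (a, a + 2) := by
          unfold setSlots'; rw [if_pos h4'.2, ← h4'.1]; unfold slLL; simp only [Prod.mk.injEq]; omega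
        exact (slot_absurd (setSlots'_mem_SB₂ hr).1 h2.1 (by rw [e]) (by rw [e])).elim
    · have e : below φ r (J φ r s) = (a, a + 2) := by
        unfold below; rw [if_neg ht, J_J hs]; unfold slLL; simp only [Prod.mk.injEq]; omega
      exact (slot_absurd (below_swap_mem_SB₂ hr (J_lt hs)) h2.2 (by rw [e]; rfl) (by rw [e]; rfl)).elim
  · exact dS hr hs g5 (by omega) (by omega)
  · exact dS hr hs g6 (by omega) (by omega)
  · exact dS hr hs g7 (by omega) (by omega)
  · exact dS hr hs g8 (by omega) (by omega)

/-- **The surviving chain edges of a row end `Bl_N` are drawn.** [folklore] -/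
theorem drawn_chain_blN (hN : 0 < N φ) {r : ℕ} (hr : r < N φ) (hi : a / 5 = blIdx φ r (N φ))
    (hpat : ChainPat a b) (h1 : (a, b) ∉ SB₁ φ ∧ (b, a) ∉ SB₁ φ) (h2 : (a, b) ∉ SB₂ φ ∧ (b, a) ∉ SB₂ φ) : Drawn φ a b := by
  set s := N φ - 1 with hsdef
  have hs : s < N φ := by omega
  have hl : sF2 φ s = true := by simp only [sF2, decide_eq_true_eq]; omega
  have hA0 : siteAnchor φ r s 0 = 5 * blIdx φ r s := rfl
  have hA1 : siteAnchor φ r s 1 = 5 * blIdx φ r (N φ) + 5 := next_row_cell hr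
  have hbl : blIdx φ r (N φ) = blIdx φ r s + 2 := by unfold blIdx rowCell; omega
  obtain ⟨-, -, -, -, -, g6⟩ := F_dl (sF1 s) (sF2 φ s) (sF3 φ r s) (sF4 φ r s) (sF5 φ r s)
  obtain ⟨-, -, -, -, k1, k2, k3, k4, k5, k6⟩ := g6 hl
  rcases hpat with ⟨ho, rfl⟩ | ⟨ho, rfl | rfl⟩ | ⟨ho, rfl | rfl⟩ | ⟨ho, rfl⟩ | ⟨ho, rfl⟩
  · exact dS hr hs k1 (by omega) (by omega)
  · have hsl := (dl_slots_mem_SB₁ (φ := φ) hr hs).2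
    rw [brIdx_eq, show s + 1 = N φ by omega] at hsl
    exact (slot_absurd hsl h1.2 (by unfold slULrev; simp only; omega) (by unfold slULrev; simp only; omega)).elim
  · cases h4 : sF4 φ r s
    · exact dS hr hs (k6 h4) (by omega) (by omega)
    · have h4' : s = J φ r r ∧ (prev? φ r).isSome = true := by simpa [sF4] using h4
      have e : (setSlots' φ r).2 = (a + 2, a) := by
        unfold setSlots'; rw [if_pos h4'.2, ← h4'.1, brIdx_eq, show s + 1 = N φ by omega]
        unfold slLL; simp only [Prod.swap, Prod.mk.injEq]; omega
      exact (slot_absurd (setSlots'_mem_SB₂ hr).2 h2.2 (by rw [e]) (by rw [e])).elim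
  · exact dS hr hs k2 (by omega) (by omega)
  · exact dS hr hs k3 (by omega) (by omega)
  · exact dS hr hs k4 (by omega) (by omega)
  · exact dS hr hs k5 (by omega) (by omega)

/-- The polarity selected by the clause tile for the cell at position `V`. [folklore] -/
theorem cPols_selN (t : ℕ) {V : ℕ} (hV : V < 3) :
    (if V = 0 then (cPols φ t).1 else if V = 1 then (cPols φ t).2.1 else (cPols φ t).2.2) =
      FormulaCells.polOf φ (3 * t + 1 + V) :=
  cPols_sel t ⟨V, hV⟩

/-- **The surviving chain edges of a clause cell `K_c` are drawn.** [folklore] -/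
theorem drawn_chain_k (hN3 : N φ = 3 * T φ + 1) {c : ℕ} (hc : c < N φ) (hi : a / 5 = kIdx φ c)
    (hpat : ChainPat a b) (h1 : (a, b) ∉ SB₁ φ ∧ (b, a) ∉ SB₁ φ) (h2 : (a, b) ∉ SB₂ φ ∧ (b, a) ∉ SB₂ φ) : Drawn φ a b := by
  -- the slots at a clause cell: `UL` (the link), the literal slot
  have hUL : a % 5 = 1 → b = a + 1 → False := fun ho hb =>
    slot_absurd (klinkSlots'_mem_SB₂ hc).2 h2.1 (by show 5 * kIdx φ c + 1 = a; omega) (by show 5 * kIdx φ c + 2 = b; omega)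
  have hlit := litSlot_mem_SB₁ hN3 hc
  have hLL : FormulaCells.polOf φ c = true → a % 5 = 1 → b = a + 2 → False := fun hp ho hb => by
    unfold litSlot at hlit; rw [if_pos hp] at hlit
    exact slot_absurd hlit h1.1 (by unfold slLL; simp only; omega) (by unfold slLL; simp only; omega)
  have hLR : FormulaCells.polOf φ c = false → a % 5 = 3 → b = a + 1 → False := fun hp ho hb => by
    unfold litSlot at hlit; rw [hp, if_neg Bool.false_ne_true] at hlit
    exact slot_absurd hlit h1.1 (by unfold slLR; simp only; omega) (by unfold slLR; simp only; omega)
  by_cases h0 : c = 0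
  · subst h0
    have hK0 : k0Anchor φ 0 = 5 * kIdx φ 0 := rfl
    obtain ⟨g1, g2, g3, g4, g5, g6, -⟩ := mem_k0Edges (FormulaCells.polOf φ 0)
    rcases hpat with ⟨ho, rfl⟩ | ⟨ho, rfl | rfl⟩ | ⟨ho, rfl | rfl⟩ | ⟨ho, rfl⟩ | ⟨ho, rfl⟩
    · exact dK g1 (by omega) (by omega)
    · exact (hUL ho rfl).elim
    · cases hp : FormulaCells.polOf φ 0
      · exact dK (g6 hp).1 (by omega) (by omega)
      · exact (hLL hp ho rfl).elim
    · exact dK g2 (by omega) (by omega)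
    · exact dK g3 (by omega) (by omega)
    · cases hp : FormulaCells.polOf φ 0
      · exact (hLR hp ho rfl).elim
      · exact dK (g5 hp).1 (by omega) (by omega)
    · exact dK g4 (by omega) (by omega)
  · set t := (c - 1) / 3 with htdef
    set V := (c - 1) % 3 with hVdef
    have hcV : c = 3 * t + 1 + V := by omega
    have ht : t < T φ := by omega
    have hV : V < 3 := Nat.mod_lt _ (by omega)
    have hC0 : clauseAnchor φ t 0 = 5 * kIdx φ (3 * t + 1) := rfl
    have hkc : kIdx φ c = kIdx φ (3 * t + 1) + V := by unfold kIdx; omega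
    obtain ⟨g1, g2, g3, g4, g5, g6, -⟩ := F_clause (cPols φ t).1 (cPols φ t).2.1 (cPols φ t).2.2 hV
    rw [cPols_selN t hV, ← hcV] at g5 g6
    rcases hpat with ⟨ho, rfl⟩ | ⟨ho, rfl | rfl⟩ | ⟨ho, rfl | rfl⟩ | ⟨ho, rfl⟩ | ⟨ho, rfl⟩
    · exact dC ht g1 (by omega) (by omega)
    · exact (hUL ho rfl).elim
    · cases hp : FormulaCells.polOf φ c
      · exact dC ht (g6 hp).1 (by omega) (by omega)
      · exact (hLL hp ho rfl).elim
    · exact dC ht g2 (by omega) (by omega)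
    · exact dC ht g3 (by omega) (by omega)
    · cases hp : FormulaCells.polOf φ c
      · exact (hLR hp ho rfl).elim
      · exact dC ht (g5 hp).1 (by omega) (by omega)
    · exact dC ht g4 (by omega) (by omega)

/-- **The chain edges of the end cell are drawn** (it has no slots). [folklore] -/
theorem drawn_chain_z (hi : a / 5 = zIdx φ) (hpat : ChainPat a b) (hb : b < 5 * M φ) : Drawn φ a b := by
  obtain ⟨-, z1, z2, z3, z4, z5, z6⟩ := mem_clauseEdges_rungs false false false
  have hz := zIdx_eq (φ := φ)
  have hM := M_pos (φ := φ)
  rcases hpat with ⟨ho, rfl⟩ | ⟨ho, rfl | rfl⟩ | ⟨ho, rfl | rfl⟩ | ⟨ho, rfl⟩ | ⟨ho, rfl⟩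
  · exact dZ z1 (by omega) (by omega)
  · exact dZ z2 (by omega) (by omega)
  · exact dZ z3 (by omega) (by omega)
  · exact dZ z4 (by omega) (by omega)
  · exact dZ z5 (by omega) (by omega)
  · exact dZ z6 (by omega) (by omega)
  · exfalso; omega

end chain

/-- **Every chain edge that survived both substitutions is drawn.** [folklore] -/
theorem drawn_chain (hN : 0 < N φ) (hN3 : N φ = 3 * T φ + 1) {a b : ℕ} (hab : (chainG (M φ)).Adj a b)
    (h1 : (a, b) ∉ SB₁ φ ∧ (b, a) ∉ SB₁ φ) (h2 : (a, b) ∉ SB₂ φ ∧ (b, a) ∉ SB₂ φ) : Drawn φ a b := by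
  -- one direction of the edge table suffices
  suffices key : ∀ {a b : ℕ}, chainRelB (M φ) a b = true → ((a, b) ∉ SB₁ φ ∧ (b, a) ∉ SB₁ φ) →
      ((a, b) ∉ SB₂ φ ∧ (b, a) ∉ SB₂ φ) → Drawn φ a b by
    rw [chainG_adj] at hab
    rcases hab.2 with h | h
    exacts [key h h1 h2, (key h ⟨h1.2, h1.1⟩ ⟨h2.2, h2.1⟩).symm]
  intro a b hrel h1 h2
  rw [chainRelB_iff] at hrel
  obtain ⟨hb, hpat⟩ := hrel
  have hi : a / 5 < M φ := by omega
  rcases cell_cases hN hi with ⟨c, hc, hic⟩ | ⟨r, hr, s, hs, hirs | hirs⟩ | ⟨r, hr, hir⟩ | ⟨c, hc, hic⟩ | hiz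
  · exact drawn_chain_dummy hN hc hic hpat h1 h2
  · exact drawn_chain_bl hr hs hirs hpat h1 h2
  · exact drawn_chain_w hr hs hirs hpat h2
  · exact drawn_chain_blN hN hr hir hpat h1 h2
  · exact drawn_chain_k hN3 hc hic hpat h1 h2
  · exact drawn_chain_z hiz hpat hb

/-! ### Every edge of the gadget graph is drawn -/

/-- **Every edge of `graph₂ φ` is drawn** (for `φ` with `N = 3T + 1 > 0` cells). [folklore] -/
theorem drawn_of_adj (hN : 0 < N φ) (hN3 : N φ = 3 * T φ + 1) {a b : ℕ} (hab : (graph₂ φ).Adj a b) : Drawn φ a b := by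
  rcases graph₂_adj.1 hab with ⟨h₁, -, -, hns₂⟩ | ⟨i, hi, hGX⟩
  · rw [not_slot₂_iff] at hns₂
    rcases graph₁_adj.1 h₁ with ⟨hc, -, -, hns₁⟩ | ⟨i, hi, hGX⟩
    · rw [not_slot₁_iff] at hns₁
      exact drawn_chain hN hN3 hc hns₁ hns₂
    · exact drawn_placed₁ hi hGX hns₂
  · exact drawn_placed₂ hN3 hi hGX

/-- **The dictionary**: two global vertices are adjacent in `graph₂ φ` iff some local edge of a placed
tile joins them — the hypothesis `hadj` of `LOT2003_lemma4_gadgets_of_family` for the assembled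
drawing. [folklore] -/
theorem adj_iff_drawn (hN : 0 < N φ) (hN3 : N φ = 3 * T φ + 1) {gp : ℕ → GridPoint} {a b : ℕ} :
    (graph₂ φ).Adj a b ↔ ∃ d ∈ (assemble (placements φ) (totalV φ) gp).edges, (d.1 = a ∧ d.2.1 = b) ∨ (d.1 = b ∧ d.2.1 = a) := by
  constructor
  · intro h
    obtain ⟨P, hP, e, he, h⟩ := drawn_of_adj hN hN3 h
    exact ⟨_, mem_assemble_edges.2 ⟨P, hP, e, he, rfl⟩, h⟩
  · rintro ⟨d, hd, h⟩
    obtain ⟨P, hP, e, he, rfl⟩ := mem_assemble_edges.1 hd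
    rcases h with ⟨rfl, rfl⟩ | ⟨rfl, rfl⟩
    · exact localEdge_adj hN hN3 hP he
    · exact (localEdge_adj hN hN3 hP he).symm

end LOTDrawing

end Literature.Barriers.CriticalPhenomena.GridSAW
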